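import Literature.Combinatorics.Optimization.PatternMatrixPsdRank
import Literature.Analysis.Convex.ConeLift
import HarnessLib

/-!
# Basic properties of the positive semidefinite rank (Fawzi–Gouveia–Parrilo–Robinson–Thomas 2015, §2)

Source: H. Fawzi, J. Gouveia, P. A. Parrilo, R. Z. Robinson, R. R. Thomas, *Positive semidefinite
rank*, Math. Program. Ser. B 153 (2015) 133–177 = arXiv:1407.4095 [FawziEtAl2015]; held text
`paper:arxiv-1407.4095` (arXiv source; theorem numbers below are those of that version, which the
cell's memos LIT-1/LIT-3/LIT-6 also use; `pNN` = held-text chunk).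

Vocabulary. The tree's `Literature.Combinatorics.Optimization.HasPsdFactorization M r`
(`PatternMatrixPsdRank.lean`): `M i j = Tr(A_i B_j)` with `A_i, B_j` real symmetric psd `r × r` —
exactly FGPRT Definition 2.2 (p05: "a psd factorization of `M` of size `k` is a collection of psd
matrices `A_1,…,A_p, B_1,…,B_q ∈ S^k_+` such that `M_{ij} = ⟨A_i, B_j⟩`; the psd rank of `M`,
`rank_psd(M)`, is the smallest integer `k` for which `M` admits a psd factorization of size `k`").
No `psdRank` function is introduced (tree convention, cf. `CorrelationPolytopePsdRank.lean`):
"`rank_psd(M) ≤ k`" is `HasPsdFactorization M k`, "`rank_psd(M) ≥ k`" is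
`∀ r < k, ¬ HasPsdFactorization M r`. Nonnegative factorizations (Definition 2.4) are inlined as
`M i j = Σ_l U i l * V l j`, `U, V ≥ 0`, as in `Literature.Barriers.PneNP.HasEFOfSize.exists_nonneg_factorisation`.

Contents (p05–p08 of the held text):
* API: `HasPsdFactorization.mono` (monotone in the size), `.transpose` (Thm 2.9 (i)),
  `.submatrix`, `.zero_iff`.
* Proposition 2.5, `rank(M) ≤ C(rank_psd(M)+1, 2)`, i.e. `½√(1+8 rank M) − ½ ≤ rank_psd M`:
  NAMED FACT `FawziEtAl2015_prop25_rank` (the symmetric vectorisation `A ↦ svec(A) ∈ ℝ^{C(k+1,2)}`);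
  the other two inequalities `rank_psd ≤ rank_+ ≤ min(p,q)` are PROVED
  (`HasPsdFactorization.of_nonnegFactorization`, `.of_entry_nonneg_card_cols/rows`).
* Proposition 2.8 (ranks one and two): NAMED FACT `FawziEtAl2015_prop28` (rank 2 ⇒ nonnegative
  rank 2 is Cohen–Rothblum 1993), DISCHARGED (`FawziEtAl2015_prop28_holds`; the Cohen–Rothblum step is
  `exists_nonnegFactorization_two_of_rank_le_two`: the normalised nonzero rows lie on an affine line and
  the two extreme ones generate).
* Theorem 2.9 (ii)–(v): PROVED (`.rescale_iff`, `.add`, `.mulRight/.mulLeft`, `.hadamardSq`,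
  and the rank form `hasPsdFactorization_hadamardSq_rank` via `exists_biFactorization_of_rank`).
* Theorem 2.10 (block lower-triangular matrices, `rank_psd [P 0; Q R] ≥ rank_psd P + rank_psd R`):
  NAMED FACT `FawziEtAl2015_thm210`; the equality half for `Q = 0` (`≤`) is PROVED
  (`HasPsdFactorization.fromBlocks_diag`).
* Example 2.11 (`rank_psd` of a diagonal matrix = number of nonzero diagonal entries; `rank_psd(I_n) = n`)
  PROVED through the psd fooling-set bound `HasPsdFactorization.card_le_of_triangular`
  (`tr(A B) = 0 ⇒ A B = 0` for psd `A, B`, Proposition 2.1).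
* Theorem 2.12 / Remark 2.14 (the set of matrices of psd rank `≤ k` is closed): NAMED FACT
  `FawziEtAl2015_thm212`; Lemma 2.13 (= Lemma 6.4, trace normalisation of the factors): NAMED FACT
  `FawziEtAl2015_lemma213`.
* Kronecker products (p07, "the inequality `rank_psd(M ⊗ N) ≤ rank_psd(M) rank_psd(N)` is always
  true"): PROVED (`HasPsdFactorization.kronecker`).
* The normalisation step "`Σ_A` may be assumed invertible, `F_i = Σ_A^{-1/2} A_i Σ_A^{-1/2}`, `Σ F_i = I`"
  shared by the proofs of Lemma 6.4 and Proposition 3.8, at fixed size: PROVED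
  (`exists_posSemidef_sum_eq_one_congr`: psd `F_i` with `Σ_i F_i = I_k` and `A_i = Rᵀ F_i R`).

NOT here: §2.2 (rational / Hermitian psd rank), Theorem 2.10's `≥` proof (range/kernel splitting),
the compactness proof of Theorem 2.12.
-/

noncomputable section

open Matrix Finset
open scoped MatrixOrder Kronecker

namespace Literature.Combinatorics.Optimization

open Literature.Analysis.Convex (selMatrix padMatrix padMatrix_apply posSemidef_padMatrix
  selMatrix_transpose_mul_self selMatrix_transpose_mul_of_ne)

variable {ι κ : Type*}

/-! ### Padding and re-indexing tools -/

/-- `Tr(P X Pᵀ · P Y Pᵀ) = Tr(X Y)` for the selection matrix `P` of an injective map. [folklore] -/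
private theorem trace_padMatrix_mul_padMatrix {m m' : ℕ} {e : Fin m → Fin m'}
    (he : Function.Injective e) (X Y : Matrix (Fin m) (Fin m) ℝ) :
    (padMatrix e X * padMatrix e Y).trace = (X * Y).trace := by
  rw [padMatrix_apply, padMatrix_apply]
  calc (selMatrix e * X * (selMatrix e)ᵀ * (selMatrix e * Y * (selMatrix e)ᵀ)).trace
      = (selMatrix e * (X * ((selMatrix e)ᵀ * selMatrix e) * Y) * (selMatrix e)ᵀ).trace := by
        simp only [Matrix.mul_assoc]
    _ = ((selMatrix e)ᵀ * selMatrix e * (X * ((selMatrix e)ᵀ * selMatrix e) * Y)).trace := by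
        rw [Matrix.trace_mul_cycle]
    _ = (X * Y).trace := by
        rw [selMatrix_transpose_mul_self he, Matrix.one_mul, Matrix.mul_one]

/-- `Tr(P X Pᵀ · Q Y Qᵀ) = 0` for selection matrices of maps with disjoint ranges. [folklore] -/
private theorem trace_padMatrix_mul_padMatrix_of_ne {m₁ m₂ m' : ℕ} {e : Fin m₁ → Fin m'}
    {f : Fin m₂ → Fin m'} (h : ∀ a b, e a ≠ f b) (X : Matrix (Fin m₁) (Fin m₁) ℝ)
    (Y : Matrix (Fin m₂) (Fin m₂) ℝ) : (padMatrix e X * padMatrix f Y).trace = 0 := by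
  rw [padMatrix_apply, padMatrix_apply]
  calc (selMatrix e * X * (selMatrix e)ᵀ * (selMatrix f * Y * (selMatrix f)ᵀ)).trace
      = (selMatrix e * (X * ((selMatrix e)ᵀ * selMatrix f) * Y) * (selMatrix f)ᵀ).trace := by
        simp only [Matrix.mul_assoc]
    _ = 0 := by rw [selMatrix_transpose_mul_of_ne h, Matrix.mul_zero, Matrix.zero_mul,
        Matrix.mul_zero, Matrix.zero_mul, Matrix.trace_zero]

/-- The two halves of `Fin (r + s)` have disjoint images. [folklore] -/
private theorem castAdd_ne_natAdd {r s : ℕ} (a : Fin r) (b : Fin s) :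
    Fin.castAdd s a ≠ Fin.natAdd r b := by
  intro h
  have := congrArg Fin.val h
  simp only [Fin.val_castAdd, Fin.val_natAdd] at this
  omega

/-! ### Elementary API (monotonicity, transposition, submatrices) -/

/-- A psd factorization of size `r` pads to one of any size `s ≥ r` (zero blocks): "`rank_psd(M) ≤ r`"
is monotone in `r`. [cite: FawziEtAl2015, Def. 2.2 (p05: "smallest integer k")] -/
theorem HasPsdFactorization.mono {M : ι → κ → ℝ} {r s : ℕ} (h : HasPsdFactorization M r)
    (hrs : r ≤ s) : HasPsdFactorization M s := by
  obtain ⟨A, B, hA, hB, hM⟩ := h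
  have hinj : Function.Injective (Fin.castLE hrs) := Fin.castLE_injective hrs
  refine ⟨fun i => padMatrix (Fin.castLE hrs) (A i), fun j => padMatrix (Fin.castLE hrs) (B j),
    fun i => posSemidef_padMatrix (hA i), fun j => posSemidef_padMatrix (hB j), fun i j => ?_⟩
  rw [trace_padMatrix_mul_padMatrix hinj, hM]

/-- **FGPRT Theorem 2.9 (i)**: `rank_psd(M) = rank_psd(Mᵀ)` — a psd factorization of `M` is one of
`Mᵀ` with the roles of the factors exchanged (`Tr(A B) = Tr(B A)`).
[cite: FawziEtAl2015, Thm. 2.9 (i) (p06)] -/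
theorem HasPsdFactorization.transpose {M : ι → κ → ℝ} {r : ℕ} (h : HasPsdFactorization M r) :
    HasPsdFactorization (fun j i => M i j) r := by
  obtain ⟨A, B, hA, hB, hM⟩ := h
  exact ⟨B, A, hB, hA, fun j i => by change M i j = _; rw [hM, Matrix.trace_mul_comm]⟩

/-- Transposition does not change the psd rank (iff form of Theorem 2.9 (i)).
[cite: FawziEtAl2015, Thm. 2.9 (i) (p06)] -/
theorem hasPsdFactorization_transpose_iff {M : ι → κ → ℝ} {r : ℕ} :
    HasPsdFactorization (fun j i => M i j) r ↔ HasPsdFactorization M r :=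
  ⟨fun h => h.transpose, fun h => h.transpose⟩

/-- Submatrices: a psd factorization of `M` restricts to one of `M ∘ (f × g)` of the same size
(used on p14, Example 5.1: "`D_n` is a submatrix of `D_{C(k+1,2)}` … so `rank_psd(D_n) ≤ k`").
[cite: FawziEtAl2015, Ex. 5.1 (p14, submatrix step)] -/
theorem HasPsdFactorization.submatrix {ι' κ' : Type*} {M : ι → κ → ℝ} {r : ℕ}
    (h : HasPsdFactorization M r) (f : ι' → ι) (g : κ' → κ) :
    HasPsdFactorization (fun i j => M (f i) (g j)) r := by
  obtain ⟨A, B, hA, hB, hM⟩ := h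
  exact ⟨fun i => A (f i), fun j => B (g j), fun i => hA _, fun j => hB _, fun i j => hM _ _⟩

/-- Size `0`: only the zero matrix has a psd factorization of size `0` (so "`rank_psd(M) ≥ 1`" for
`M ≠ 0`, the implicit convention `k ≥ 1` of Definition 2.2). [cite: FawziEtAl2015, Def. 2.2 (p05)] -/
theorem hasPsdFactorization_zero_iff {M : ι → κ → ℝ} :
    HasPsdFactorization M 0 ↔ ∀ i j, M i j = 0 := by
  constructor
  · rintro ⟨A, B, -, -, hM⟩ i j
    rw [hM]
    rfl
  · intro h
    exact ⟨fun _ => 0, fun _ => 0, fun _ => PosSemidef.zero, fun _ => PosSemidef.zero,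
      fun i j => by rw [h, Matrix.zero_mul, trace_zero]⟩

/-! ### Proposition 2.5: `½√(1+8 rank M) − ½ ≤ rank_psd M ≤ rank_+ M ≤ min(p,q)` -/

/-- **FGPRT Proposition 2.5, first inequality** (p05, verbatim): "If `M ∈ ℝ^{p×q}_+` is a nonnegative
matrix, then `½√(1+8 rank(M)) − ½ ≤ rank_psd(M)`", equivalently (p14, (14)) "`rank(M) ≤
C(rank_psd(M)+1, 2)`": a psd factorization `M_{ij} = ⟨A_i,B_j⟩` of size `k` gives the ordinary
factorization `⟨svec(A_i), svec(B_j)⟩` through `ℝ^{C(k+1,2)}`. Typed: a real matrix with a psd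
factorization of size `k` has rank at most `C(k+1,2)`. [cite: FawziEtAl2015, Prop. 2.5 (p05)] -/
def FawziEtAl2015_prop25_rank : Prop :=
  ∀ (ι κ : Type) [Fintype ι] [Fintype κ] (M : Matrix ι κ ℝ) (k : ℕ),
    HasPsdFactorization M k → M.rank ≤ (k + 1).choose 2

/-- The printed square-root form of Proposition 2.5: `½√(1+8 rank(M)) − ½ ≤ k` for every psd
factorization of size `k` (from `rank M ≤ k(k+1)/2`). [cite: FawziEtAl2015, Prop. 2.5 (p05, eq. (1))] -/
theorem FawziEtAl2015_prop25_rank.sqrt_form (hfact : FawziEtAl2015_prop25_rank) {ι κ : Type}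
    [Fintype ι] [Fintype κ] (M : Matrix ι κ ℝ) {k : ℕ} (h : HasPsdFactorization M k) :
    Real.sqrt (1 + 8 * (M.rank : ℝ)) / 2 - 1 / 2 ≤ k := by
  have hr : (M.rank : ℝ) ≤ ((k + 1).choose 2 : ℕ) := by exact_mod_cast hfact ι κ M k h
  rw [Nat.choose_two_right] at hr
  have hk : (((k + 1) * (k + 1 - 1) / 2 : ℕ) : ℝ) = (k : ℝ) * (k + 1) / 2 := by
    rw [Nat.add_sub_cancel]
    have h2 : ((k + 1) * k) % 2 = 0 := by
      have := Nat.even_mul_succ_self k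
      rw [mul_comm] at this
      exact Nat.even_iff.mp this
    rw [Nat.cast_div (Nat.dvd_of_mod_eq_zero h2) (by norm_num)]
    push_cast
    ring
  rw [hk] at hr
  have hk0 : (0 : ℝ) ≤ k := Nat.cast_nonneg k
  have hsq : Real.sqrt (1 + 8 * (M.rank : ℝ)) ≤ 2 * k + 1 := by
    rw [Real.sqrt_le_left (by linarith)]
    nlinarith
  linarith

/-- **FGPRT Proposition 2.5, second inequality `rank_psd(M) ≤ rank_+(M)`** (p05): a nonnegative
factorization `M_{ij} = a_iᵀ b_j`, `a_i, b_j ∈ ℝ^k_+`, gives the psd factorization `A_i = diag(a_i)`,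
`B_j = diag(b_j)` of the same size. [cite: FawziEtAl2015, Prop. 2.5 (p05)] -/
theorem HasPsdFactorization.of_nonnegFactorization {M : ι → κ → ℝ} {k : ℕ} (U : ι → Fin k → ℝ)
    (V : Fin k → κ → ℝ) (hU : ∀ i l, 0 ≤ U i l) (hV : ∀ l j, 0 ≤ V l j)
    (hM : ∀ i j, M i j = ∑ l, U i l * V l j) : HasPsdFactorization M k := by
  refine ⟨fun i => diagonal (U i), fun j => diagonal (fun l => V l j),
    fun i => posSemidef_diagonal_iff.mpr (hU i), fun j => posSemidef_diagonal_iff.mpr (fun l => hV l j),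
    fun i j => ?_⟩
  rw [diagonal_mul_diagonal, trace_diagonal, hM]

/-- **FGPRT Proposition 2.5, third inequality `rank_+(M) ≤ min(p,q)`, psd form** (p05: "`M = M I_q`"):
an entrywise nonnegative matrix with `q` columns has a psd (indeed nonnegative) factorization of
size `q`. [cite: FawziEtAl2015, Prop. 2.5 (p05)] -/
theorem HasPsdFactorization.of_entry_nonneg_card_cols [Fintype κ] {M : ι → κ → ℝ}
    (hM : ∀ i j, 0 ≤ M i j) : HasPsdFactorization M (Fintype.card κ) := by
  classical
  let e : κ ≃ Fin (Fintype.card κ) := Fintype.equivFin κ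
  refine HasPsdFactorization.of_nonnegFactorization (fun i l => M i (e.symm l))
    (fun l j => if e.symm l = j then 1 else 0) (fun i l => hM _ _)
    (fun l j => by split_ifs <;> norm_num) (fun i j => ?_)
  rw [Fintype.sum_equiv e.symm (fun l => M i (e.symm l) * if e.symm l = j then 1 else 0)
    (fun t => M i t * if t = j then 1 else 0) (fun l => rfl)]
  simp

/-- **FGPRT Proposition 2.5, third inequality, row form** (p05: "`M = I_p M`"): an entrywise
nonnegative matrix with `p` rows has a psd factorization of size `p`. [cite: FawziEtAl2015, Prop. 2.5 (p05)] -/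
theorem HasPsdFactorization.of_entry_nonneg_card_rows [Fintype ι] {M : ι → κ → ℝ}
    (hM : ∀ i j, 0 ≤ M i j) : HasPsdFactorization M (Fintype.card ι) :=
  (HasPsdFactorization.of_entry_nonneg_card_cols (M := fun j i => M i j) fun j i => hM i j).transpose

/-! ### Proposition 2.8: ranks one and two -/

/-- **FGPRT Proposition 2.8** (p06, verbatim): "For a nonnegative matrix `M ∈ ℝ^{p×q}_+` the following is
true: `rank(M) = 1 ⇔ rank_+(M) = 1 ⇔ rank_psd(M) = 1`. Furthermore, we have the following
implication: `rank(M) = 2 ⇒ rank_+(M) = rank_psd(M) = 2`" (the last via Cohen–Rothblum: rank two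
nonnegative matrices have nonnegative rank two). Typed for entrywise nonnegative real `M`:
(a) `rank M = 1` iff `M ≠ 0` has a nonnegative factorization of size `1`, iff `M ≠ 0` has a psd
factorization of size `1`; (b) `rank M = 2` implies a nonnegative factorization of size `2`, a psd
factorization of size `2`, and none of size `1`. [cite: FawziEtAl2015, Prop. 2.8 (p06)] -/
def FawziEtAl2015_prop28 : Prop :=
  ∀ (ι κ : Type) [Fintype ι] [Fintype κ] (M : Matrix ι κ ℝ), (∀ i j, 0 ≤ M i j) →
    ((M.rank = 1 ↔ M ≠ 0 ∧ ∃ (a : ι → ℝ) (b : κ → ℝ), (∀ i, 0 ≤ a i) ∧ (∀ j, 0 ≤ b j) ∧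
        ∀ i j, M i j = a i * b j) ∧
     (M.rank = 1 ↔ M ≠ 0 ∧ HasPsdFactorization M 1)) ∧
    (M.rank = 2 →
      (∃ (U : ι → Fin 2 → ℝ) (V : Fin 2 → κ → ℝ), (∀ i l, 0 ≤ U i l) ∧ (∀ l j, 0 ≤ V l j) ∧
        ∀ i j, M i j = ∑ l, U i l * V l j) ∧
      HasPsdFactorization M 2 ∧ ¬ HasPsdFactorization M 1)

/-! ### Theorem 2.9: diagonal scaling, sums, products, Hadamard squares -/

/-- **FGPRT Theorem 2.9 (ii)**, scaling: a psd factorization of `M` gives one of `D₁ M D₂ =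
(c_i M_{ij} d_j)` of the same size for nonnegative diagonal `D₁ = diag(c)`, `D₂ = diag(d)`
(`⟨c_i A_i, d_j B_j⟩`). [cite: FawziEtAl2015, Thm. 2.9 (ii) (p06)] -/
theorem HasPsdFactorization.rescale {M : ι → κ → ℝ} {r : ℕ} (h : HasPsdFactorization M r)
    {c : ι → ℝ} {d : κ → ℝ} (hc : ∀ i, 0 ≤ c i) (hd : ∀ j, 0 ≤ d j) :
    HasPsdFactorization (fun i j => c i * M i j * d j) r := by
  obtain ⟨A, B, hA, hB, hM⟩ := h
  refine ⟨fun i => c i • A i, fun j => d j • B j, fun i => (hA i).smul (hc i),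
    fun j => (hB j).smul (hd j), fun i j => ?_⟩
  change c i * M i j * d j = _
  rw [Matrix.smul_mul, Matrix.mul_smul, trace_smul, trace_smul, hM, smul_eq_mul, smul_eq_mul]
  ring

/-- **FGPRT Theorem 2.9 (ii)** (p06, verbatim): "If `D₁ ∈ ℝ^{p×p}_+, D₂ ∈ ℝ^{q×q}_+` are diagonal
matrices with strictly positive elements on the diagonal, then `rank_psd(D₁ M D₂) = rank_psd(M)`."
[cite: FawziEtAl2015, Thm. 2.9 (ii) (p06)] -/
theorem hasPsdFactorization_rescale_iff {M : ι → κ → ℝ} {r : ℕ} {c : ι → ℝ} {d : κ → ℝ}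
    (hc : ∀ i, 0 < c i) (hd : ∀ j, 0 < d j) :
    HasPsdFactorization (fun i j => c i * M i j * d j) r ↔ HasPsdFactorization M r := by
  refine ⟨fun h => ?_, fun h => h.rescale (fun i => (hc i).le) (fun j => (hd j).le)⟩
  have h' := h.rescale (c := fun i => (c i)⁻¹) (d := fun j => (d j)⁻¹)
    (fun i => inv_nonneg.mpr (hc i).le) (fun j => inv_nonneg.mpr (hd j).le)
  have hfun : (fun i j => (c i)⁻¹ * (c i * M i j * d j) * (d j)⁻¹) = M := by
    funext i j
    field_simp [(hc i).ne', (hd j).ne']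
  rwa [hfun] at h'

/-- **FGPRT Theorem 2.9 (iii)** (p06, verbatim): "If `N ∈ ℝ^{p×q}_+`, then `rank_psd(M+N) ≤ rank_psd(M)
+ rank_psd(N)`" — block-diagonal factors `C_i = A_i ⊕ A'_i`, `D_j = B_j ⊕ B'_j`.
[cite: FawziEtAl2015, Thm. 2.9 (iii) (p06)] -/
theorem HasPsdFactorization.add {M N : ι → κ → ℝ} {r s : ℕ} (hM : HasPsdFactorization M r)
    (hN : HasPsdFactorization N s) : HasPsdFactorization (fun i j => M i j + N i j) (r + s) := by
  obtain ⟨A, B, hA, hB, hMf⟩ := hM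
  obtain ⟨A', B', hA', hB', hNf⟩ := hN
  let e : Fin r → Fin (r + s) := Fin.castAdd s
  let f : Fin s → Fin (r + s) := Fin.natAdd r
  have he : Function.Injective e := Fin.castAdd_injective r s
  have hf : Function.Injective f := Fin.natAdd_injective s r
  have hef : ∀ a b, e a ≠ f b := castAdd_ne_natAdd
  have hfe : ∀ b a, f b ≠ e a := fun b a h => hef a b h.symm
  refine ⟨fun i => padMatrix e (A i) + padMatrix f (A' i), fun j => padMatrix e (B j) + padMatrix f (B' j),
    fun i => (posSemidef_padMatrix (hA i)).add (posSemidef_padMatrix (hA' i)),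
    fun j => (posSemidef_padMatrix (hB j)).add (posSemidef_padMatrix (hB' j)), fun i j => ?_⟩
  change M i j + N i j = _
  rw [Matrix.add_mul, Matrix.mul_add, Matrix.mul_add, trace_add, trace_add, trace_add,
    trace_padMatrix_mul_padMatrix he, trace_padMatrix_mul_padMatrix hf,
    trace_padMatrix_mul_padMatrix_of_ne hef, trace_padMatrix_mul_padMatrix_of_ne hfe, hMf, hNf]
  ring

/-- **FGPRT Theorem 2.9 (iv)**, right multiplication (p06, verbatim): "If `N ∈ ℝ^{q×r}_+` then
`rank_psd(MN) ≤ min(rank_psd(M), rank_psd(N))`" — here the half `rank_psd(MN) ≤ rank_psd(M)`: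
`C_j = Σ_t N_{tj} B_t ∈ S^k_+`. [cite: FawziEtAl2015, Thm. 2.9 (iv) (p06)] -/
theorem HasPsdFactorization.mulRight [Fintype κ] {τ : Type*} {M : ι → κ → ℝ} {N : κ → τ → ℝ}
    {r : ℕ} (hM : HasPsdFactorization M r) (hN : ∀ t j, 0 ≤ N t j) :
    HasPsdFactorization (fun i j => ∑ t, M i t * N t j) r := by
  obtain ⟨A, B, hA, hB, hMf⟩ := hM
  refine ⟨A, fun j => ∑ t, N t j • B t, hA, fun j => ?_, fun i j => ?_⟩
  · exact posSemidef_sum _ fun t _ => (hB t).smul (hN t j)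
  · change ∑ t, M i t * N t j = _
    rw [Matrix.mul_sum, trace_sum]
    refine sum_congr rfl fun t _ => ?_
    rw [Matrix.mul_smul, trace_smul, smul_eq_mul, hMf]
    exact mul_comm _ _

/-- **FGPRT Theorem 2.9 (iv)**, left multiplication: `rank_psd(NM) ≤ rank_psd(M)` for entrywise
nonnegative `N` (the "similar argument" of the printed proof, via transposition).
[cite: FawziEtAl2015, Thm. 2.9 (iv) (p06)] -/
theorem HasPsdFactorization.mulLeft [Fintype ι] {τ : Type*} {M : ι → κ → ℝ} {N : τ → ι → ℝ}
    {r : ℕ} (hM : HasPsdFactorization M r) (hN : ∀ t i, 0 ≤ N t i) :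
    HasPsdFactorization (fun t j => ∑ i, N t i * M i j) r := by
  have h := (hM.transpose.mulRight (N := fun i t => N t i) fun i t => hN t i).transpose
  have hfun : (fun t j => ∑ i, N t i * M i j) = fun t j => ∑ i, M i j * N t i := by
    funext t j
    exact sum_congr rfl fun i _ => mul_comm _ _
  rw [hfun]
  exact h

/-- **FGPRT Theorem 2.9 (v)**, factorization form (p07): an ordinary factorization `M_{ij} = ⟨a_i,b_j⟩`
through `ℝ^r` gives the psd factorization `A_i = a_i a_iᵀ`, `B_j = b_j b_jᵀ` of the Hadamard square
`M ∘ M`, of size `r`: `⟨a_i a_iᵀ, b_j b_jᵀ⟩ = ⟨a_i, b_j⟩²`. [cite: FawziEtAl2015, Thm. 2.9 (v) (p06–p07)] -/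
theorem HasPsdFactorization.hadamardSq {M : ι → κ → ℝ} {r : ℕ} (a : ι → Fin r → ℝ)
    (b : κ → Fin r → ℝ) (hM : ∀ i j, M i j = ∑ l, a i l * b j l) :
    HasPsdFactorization (fun i j => M i j ^ 2) r := by
  refine ⟨fun i => vecMulVec (a i) (a i), fun j => vecMulVec (b j) (b j),
    fun i => by simpa using posSemidef_vecMulVec_self_star (a i),
    fun j => by simpa using posSemidef_vecMulVec_self_star (b j), fun i j => ?_⟩
  change M i j ^ 2 = _
  rw [vecMulVec_mul_vecMulVec, trace_vecMulVec, dotProduct_smul, smul_eq_mul, hM i j, sq]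
  simp only [dotProduct]

/-- Rank factorization (the first line of the proof of Theorem 2.9 (v), p07: "Let `M_{ij} = ⟨a_i, b_j⟩`
be a factorization of `M` where `a_i, b_j ∈ ℝ^r` where `r = rank(M)`"): a real matrix of rank `≤ r`
(finitely many rows and columns) factors through `ℝ^r`, `M_{ij} = Σ_{l<r} a_{il} b_{jl}` (coordinates
of the columns in a basis of the column span, padded with zeros).
[cite: FawziEtAl2015, Thm. 2.9 (v) proof (p07, rank factorization)] -/
theorem exists_biFactorization_of_rank_le [Fintype ι] [Fintype κ] (M : Matrix ι κ ℝ) {r : ℕ}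
    (hr : M.rank ≤ r) :
    ∃ (a : ι → Fin r → ℝ) (b : κ → Fin r → ℝ), ∀ i j, M i j = ∑ l, a i l * b j l := by
  classical
  let W : Submodule ℝ (ι → ℝ) := Submodule.span ℝ (Set.range M.col)
  let d := Module.finrank ℝ W
  have hd : d = M.rank := (rank_eq_finrank_span_cols M).symm
  let bW := Module.finBasis ℝ W
  have hmem : ∀ j, M.col j ∈ W := fun j => Submodule.subset_span ⟨j, rfl⟩
  have hdr : d ≤ r := hd ▸ hr
  -- coordinates of column `j` in the basis `bW`, padded with zeros up to `r`
  let a : ι → Fin r → ℝ := fun i l => if h : (l : ℕ) < d then ((bW ⟨l, h⟩ : W) : ι → ℝ) i else 0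
  let b : κ → Fin r → ℝ := fun j l => if h : (l : ℕ) < d then bW.repr ⟨M.col j, hmem j⟩ ⟨l, h⟩ else 0
  refine ⟨a, b, fun i j => ?_⟩
  have hcol : (M.col j : ι → ℝ) = ∑ l : Fin d, bW.repr ⟨M.col j, hmem j⟩ l • ((bW l : W) : ι → ℝ) := by
    have h := bW.sum_repr ⟨M.col j, hmem j⟩
    have h' := congrArg (fun w : W => (w : ι → ℝ)) h
    simp only [Submodule.coe_sum, Submodule.coe_smul] at h'
    exact h'.symm
  have hij : M i j = ∑ l : Fin d, bW.repr ⟨M.col j, hmem j⟩ l * ((bW l : W) : ι → ℝ) i := by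
    have := congrFun hcol i
    simp only [Matrix.col_apply, Finset.sum_apply, Pi.smul_apply, smul_eq_mul] at this
    exact this
  rw [hij]
  -- compare the sum over `Fin d` with the padded sum over `Fin r`
  let emb : Fin d ↪ Fin r := ⟨Fin.castLE hdr, Fin.castLE_injective hdr⟩
  have hsplit : ∑ l : Fin r, a i l * b j l = ∑ l ∈ (univ : Finset (Fin d)).map emb, a i l * b j l := by
    symm
    refine sum_subset (subset_univ _) fun l _ hl => ?_
    have hl' : ¬ (l : ℕ) < d := by
      intro hlt
      exact hl (Finset.mem_map.mpr ⟨⟨l, hlt⟩, mem_univ _, Fin.ext rfl⟩)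
    simp [a, hl']
  rw [hsplit, sum_map]
  refine sum_congr rfl fun l _ => ?_
  have hl : ((emb l : Fin r) : ℕ) < d := by simp [emb]
  have hlfin : (⟨((emb l : Fin r) : ℕ), hl⟩ : Fin d) = l := Fin.ext (by simp [emb])
  simp only [a, b, hl, dif_pos, hlfin]
  ring

/-- **FGPRT Theorem 2.9 (v)** (p06, verbatim): "`rank_psd(M ∘ M) ≤ rank(M)`, where `∘` denotes
Hadamard (entrywise) product." [cite: FawziEtAl2015, Thm. 2.9 (v) (p06–p07)] -/
theorem hasPsdFactorization_hadamardSq_rank [Fintype ι] [Fintype κ] (M : Matrix ι κ ℝ) :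
    HasPsdFactorization (fun i j => M i j ^ 2) M.rank := by
  obtain ⟨a, b, hab⟩ := exists_biFactorization_of_rank_le M le_rfl
  exact HasPsdFactorization.hadamardSq a b hab

/-! ### Theorem 2.10: block lower-triangular matrices -/

/-- **FGPRT Theorem 2.10, equality half** (p07): block-diagonal psd factorizations — if `P` and `R`
have psd factorizations of sizes `k₁`, `k₂` then `[P 0; 0 R]` has one of size `k₁ + k₂`
("the factors … give a psd factorization of the block-diagonal matrix of size `rank_psd(P) +
rank_psd(R)`"). [cite: FawziEtAl2015, Thm. 2.10 (p07, case Q = 0)] -/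
theorem HasPsdFactorization.fromBlocks_diag {ι₁ ι₂ κ₁ κ₂ : Type*} {P : ι₁ → κ₁ → ℝ}
    {R : ι₂ → κ₂ → ℝ} {k₁ k₂ : ℕ} (hP : HasPsdFactorization P k₁) (hR : HasPsdFactorization R k₂) :
    HasPsdFactorization (Matrix.fromBlocks (Matrix.of P) 0 0 (Matrix.of R)) (k₁ + k₂) := by
  obtain ⟨A, B, hA, hB, hPf⟩ := hP
  obtain ⟨C, D, hC, hD, hRf⟩ := hR
  let e : Fin k₁ → Fin (k₁ + k₂) := Fin.castAdd k₂
  let f : Fin k₂ → Fin (k₁ + k₂) := Fin.natAdd k₁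
  have he : Function.Injective e := Fin.castAdd_injective k₁ k₂
  have hf : Function.Injective f := Fin.natAdd_injective k₂ k₁
  have hef : ∀ a b, e a ≠ f b := castAdd_ne_natAdd
  have hfe : ∀ b a, f b ≠ e a := fun b a h => hef a b h.symm
  refine ⟨Sum.elim (fun i => padMatrix e (A i)) (fun i => padMatrix f (C i)),
    Sum.elim (fun j => padMatrix e (B j)) (fun j => padMatrix f (D j)), ?_, ?_, ?_⟩
  · rintro (i | i)
    · exact posSemidef_padMatrix (hA i)
    · exact posSemidef_padMatrix (hC i)
  · rintro (j | j)
    · exact posSemidef_padMatrix (hB j)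
    · exact posSemidef_padMatrix (hD j)
  · rintro (i | i) (j | j)
    · simp only [Sum.elim_inl, fromBlocks_apply₁₁, of_apply, trace_padMatrix_mul_padMatrix he, hPf]
    · simp only [Sum.elim_inl, Sum.elim_inr, fromBlocks_apply₁₂, Matrix.zero_apply,
        trace_padMatrix_mul_padMatrix_of_ne hef]
    · simp only [Sum.elim_inl, Sum.elim_inr, fromBlocks_apply₂₁, Matrix.zero_apply,
        trace_padMatrix_mul_padMatrix_of_ne hfe]
    · simp only [Sum.elim_inr, fromBlocks_apply₂₂, of_apply, trace_padMatrix_mul_padMatrix hf, hRf]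

/-- **FGPRT Theorem 2.10** (p07, verbatim): "Let `P ∈ ℝ^{p₁×q₁}_+, Q ∈ ℝ^{p₂×q₁}_+, R ∈ ℝ^{p₂×q₂}_+` be
nonnegative matrices and let `M` be the block matrix of size `(p₁+p₂)×(q₁+q₂)`: `M = [P 0; Q R]`.
Then `rank_psd(M) ≥ rank_psd(P) + rank_psd(R)`. Furthermore, when `Q = 0` we have equality"
(also Braun–Pokutta and Lee–Wei–de Wolf, independently). Typed: a psd factorization of `[P 0; Q R]`
of size `k` yields psd factorizations of `P` and `R` of sizes `k₁, k₂` with `k₁ + k₂ ≤ k` (the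
equality half is `HasPsdFactorization.fromBlocks_diag`). [cite: FawziEtAl2015, Thm. 2.10 (p07)] -/
def FawziEtAl2015_thm210 : Prop :=
  ∀ (ι₁ ι₂ κ₁ κ₂ : Type) [Finite ι₁] [Finite ι₂] [Finite κ₁] [Finite κ₂]
    (P : ι₁ → κ₁ → ℝ) (Q : ι₂ → κ₁ → ℝ) (R : ι₂ → κ₂ → ℝ) (k : ℕ),
    HasPsdFactorization (Matrix.fromBlocks (Matrix.of P) 0 (Matrix.of Q) (Matrix.of R)) k →
      ∃ k₁ k₂ : ℕ, k₁ + k₂ ≤ k ∧ HasPsdFactorization P k₁ ∧ HasPsdFactorization R k₂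

/-! ### Example 2.11: diagonal matrices; the psd fooling-set bound -/

/-- `Tr(A B) = 0` forces `A B = 0` for real psd `A, B` (**FGPRT Proposition 2.1**, p05: "If
`A, B ∈ S^k_+` are such that `⟨A, B⟩ = 0`, then `AB = 0`"; write `B = Cᵀ C`, then `Tr(A CᵀC) =
Σ_l c_lᵀ A c_l` with nonnegative terms). [cite: FawziEtAl2015, Prop. 2.1 (p05)] -/
theorem mul_eq_zero_of_posSemidef_trace_eq_zero {k : ℕ} {A B : Matrix (Fin k) (Fin k) ℝ}
    (hA : A.PosSemidef) (hB : B.PosSemidef) (h : (A * B).trace = 0) : A * B = 0 := by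
  classical
  obtain ⟨C, hC⟩ := CStarAlgebra.nonneg_iff_eq_star_mul_self.mp hB.nonneg
  have hBC : B = Cᵀ * C := by
    rw [hC, star_eq_conjTranspose, conjTranspose_eq_transpose_of_trivial]
  -- `Tr(A Cᵀ C) = Σ_l c_lᵀ A c_l` over the rows `c_l = C l`
  have hsum : (A * B).trace = ∑ l, C l ⬝ᵥ (A *ᵥ C l) := by
    rw [hBC, ← Matrix.mul_assoc, Matrix.trace_mul_comm]
    simp only [Matrix.trace, Matrix.diag_apply, Matrix.mul_apply, Matrix.transpose_apply,
      dotProduct, Matrix.mulVec, Finset.mul_sum]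
  have hnn : ∀ l, 0 ≤ C l ⬝ᵥ (A *ᵥ C l) := fun l => by
    simpa only [star_trivial] using hA.dotProduct_mulVec_nonneg (C l)
  have hzero : ∀ l, C l ⬝ᵥ (A *ᵥ C l) = 0 := by
    have h0 : ∑ l, C l ⬝ᵥ (A *ᵥ C l) = 0 := by rw [← hsum, h]
    exact fun l => (Finset.sum_eq_zero_iff_of_nonneg fun l _ => hnn l).1 h0 l (Finset.mem_univ l)
  have hker : ∀ l, A *ᵥ C l = 0 := fun l =>
    (hA.dotProduct_mulVec_zero_iff (C l)).1 (by simpa only [star_trivial] using hzero l)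
  have hACt : A * Cᵀ = 0 := by
    ext s l
    have := congrFun (hker l) s
    simpa only [Matrix.mul_apply, Matrix.transpose_apply, Matrix.mulVec, dotProduct,
      Matrix.zero_apply, Pi.zero_apply] using this
  rw [hBC, ← Matrix.mul_assoc, hACt, Matrix.zero_mul]

/-- **The psd fooling-set bound** (corollary of Theorem 2.10 / Example 2.11): if `M` has a psd
factorization of size `k` and contains a `K × K` "triangular" pattern `M (ρ a) (γ a) ≠ 0`,
`M (ρ a) (γ b) = 0` for `a < b`, then `K ≤ k` (trace-orthogonality `A_{ρ a} B_{γ b} = 0` puts vectors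
`(B_{γ a})_{·,t_a}` and functionals `y ↦ (A_{ρ a} y)_{s_a}` in triangular position in `ℝ^k`).
[cite: FawziEtAl2015, Thm. 2.10 + Ex. 2.11 (p07, corollary)] -/
theorem HasPsdFactorization.card_le_of_triangular {M : ι → κ → ℝ} {k K : ℕ}
    (h : HasPsdFactorization M k) (ρ : Fin K → ι) (γ : Fin K → κ)
    (hdiag : ∀ a, M (ρ a) (γ a) ≠ 0) (hoff : ∀ a b, a < b → M (ρ a) (γ b) = 0) : K ≤ k := by
  classical
  obtain ⟨A, B, hA, hB, hM⟩ := h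
  have horth : ∀ a b, a < b → A (ρ a) * B (γ b) = 0 := fun a b hab =>
    mul_eq_zero_of_posSemidef_trace_eq_zero (hA _) (hB _) (by rw [← hM]; exact hoff a b hab)
  have hex : ∀ a, ∃ st : Fin k × Fin k, (A (ρ a) * B (γ a)) st.1 st.2 ≠ 0 := by
    intro a
    by_contra! hzero
    refine hdiag a ?_
    rw [hM, show A (ρ a) * B (γ a) = 0 from Matrix.ext fun s t => hzero ⟨s, t⟩, trace_zero]
  choose st hst using hex
  let v : Fin K → (Fin k → ℝ) := fun a s => B (γ a) s (st a).2
  let φ : Fin K → (Fin k → ℝ) →ₗ[ℝ] ℝ := fun a =>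
    (LinearMap.proj (st a).1).comp (Matrix.mulVecLin (A (ρ a)))
  have hφ : ∀ a b, φ a (v b) = (A (ρ a) * B (γ b)) (st a).1 (st b).2 := by
    intro a b
    simp [φ, v, mul_apply, mulVec, dotProduct]
  -- the `v a` are linearly independent: apply `φ_a` for the SMALLEST index `a` carrying a nonzero
  -- coefficient of a vanishing combination (`φ_a (v_b) = 0` for `a < b`, `c_b = 0` for `b < a`)
  have hli : LinearIndependent ℝ v := by
    rw [Fintype.linearIndependent_iff]
    intro c hc
    by_contra! hne
    obtain ⟨a₀, ha₀⟩ := hne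
    set s : Finset (Fin K) := univ.filter fun a => c a ≠ 0 with hs
    have hsne : s.Nonempty := ⟨a₀, by simp [hs, ha₀]⟩
    set a := s.min' hsne with ha
    have hca : c a ≠ 0 := by
      have hmem := s.min'_mem hsne
      rw [← ha] at hmem
      simpa [hs] using hmem
    have hlt : ∀ b, b < a → c b = 0 := by
      intro b hba
      by_contra hcb
      exact absurd (s.min'_le b (by simp [hs, hcb])) (not_le.mpr (ha ▸ hba))
    have happ := congrArg (φ a) hc
    rw [map_sum, map_zero, Finset.sum_eq_single a] at happ
    · rw [map_smul, smul_eq_mul, hφ] at happ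
      exact hca ((mul_eq_zero.1 happ).resolve_right (hst a))
    · intro b _ hba
      rcases lt_or_gt_of_ne hba with hba' | hab'
      · rw [hlt b hba', zero_smul, map_zero]
      · rw [map_smul, hφ, horth a b hab', smul_eq_mul]
        simp
    · intro hnot
      exact absurd (mem_univ a) hnot
  have := hli.fintype_card_le_finrank
  simpa using this

/-- **FGPRT Example 2.11** (p07, verbatim): "the psd rank of a nonnegative diagonal matrix is equal to
the number of nonzero diagonal elements" — typed: `diag(d)` (`d ≥ 0`) has a psd factorization of
size `k` iff `#{i : d_i ≠ 0} ≤ k`. [cite: FawziEtAl2015, Ex. 2.11 (p07)] -/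
theorem hasPsdFactorization_diagonal_iff [Fintype ι] [DecidableEq ι] {d : ι → ℝ}
    (hd : ∀ i, 0 ≤ d i) {k : ℕ} :
    HasPsdFactorization (Matrix.diagonal d) k ↔ (univ.filter fun i => d i ≠ 0).card ≤ k := by
  set S : Finset ι := univ.filter fun i => d i ≠ 0 with hS
  have hmemS : ∀ {i}, i ∈ S ↔ d i ≠ 0 := by simp [hS]
  constructor
  · intro h
    -- triangular pattern on the support
    let e : Fin S.card ≃ S := (S.equivFin).symm
    refine h.card_le_of_triangular (fun a => (e a : ι)) (fun a => (e a : ι)) (fun a => ?_)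
      (fun a b hab => ?_)
    · rw [diagonal_apply_eq]
      exact hmemS.mp (e a).2
    · have hne : (e a : ι) ≠ (e b : ι) := fun heq =>
        (ne_of_lt hab) (e.injective (Subtype.ext heq))
      exact diagonal_apply_ne _ hne
  · intro hk
    refine HasPsdFactorization.mono ?_ hk
    -- nonnegative factorization of size `#S` along an enumeration of the support
    let emb : Fin S.card → ι := fun l => ((S.equivFin).symm l : ι)
    have hemb_mem : ∀ l, d (emb l) ≠ 0 := fun l => hmemS.mp ((S.equivFin).symm l).2
    have hemb_inj : Function.Injective emb := fun l l' h =>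
      (S.equivFin).symm.injective (Subtype.ext h)
    refine HasPsdFactorization.of_nonnegFactorization
      (fun i l => if i = emb l then d i else 0) (fun l j => if j = emb l then 1 else 0)
      (fun i l => by split_ifs <;> simp [hd i]) (fun l j => by split_ifs <;> norm_num)
      (fun i j => ?_)
    by_cases hi : d i = 0
    · -- row `i` outside the support: both sides vanish
      have hij : Matrix.diagonal d i j = 0 := by
        by_cases h : i = j
        · subst h; rw [diagonal_apply_eq, hi]
        · exact diagonal_apply_ne _ h
      rw [hij]
      symm
      refine Finset.sum_eq_zero fun l _ => ?_
      have : i ≠ emb l := fun h => hemb_mem l (h ▸ hi)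
      simp [this]
    · -- row `i = emb l₀`
      obtain ⟨l₀, hl₀⟩ : ∃ l₀, emb l₀ = i :=
        ⟨S.equivFin ⟨i, hmemS.mpr hi⟩, by simp [emb]⟩
      rw [Finset.sum_eq_single l₀]
      · subst hl₀
        by_cases h : emb l₀ = j
        · subst h; simp
        · rw [diagonal_apply_ne _ h]
          simp [Ne.symm h]
      · intro l _ hl
        have : i ≠ emb l := by
          intro h
          exact hl (hemb_inj (h.symm.trans hl₀.symm))
        simp [this]
      · intro hnot
        exact absurd (mem_univ _) hnot

/-- **FGPRT Example 2.11** (p07): "the psd rank of the identity matrix `I_n` is equal to `n`" —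
typed: `I` (rows and columns `ι`) has a psd factorization of size `k` iff `|ι| ≤ k`.
[cite: FawziEtAl2015, Ex. 2.11 (p07)] -/
theorem hasPsdFactorization_one_iff [Fintype ι] [DecidableEq ι] {k : ℕ} :
    HasPsdFactorization (1 : Matrix ι ι ℝ) k ↔ Fintype.card ι ≤ k := by
  have h := hasPsdFactorization_diagonal_iff (ι := ι) (d := fun _ => (1 : ℝ)) (fun _ => zero_le_one)
    (k := k)
  rw [← diagonal_one]
  rw [show (univ.filter fun _ : ι => (1 : ℝ) ≠ 0) = univ from filter_true_of_mem fun _ _ => one_ne_zero,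
    card_univ] at h
  exact h

/-! ### Kronecker products -/

/-- Trace is invariant under re-indexing along an equivalence. [folklore] -/
private theorem trace_submatrix_equiv' {p q : Type*} [Fintype p] [Fintype q] (X : Matrix q q ℝ)
    (e : p ≃ q) : (X.submatrix e e).trace = X.trace := by
  simp only [trace, diag_apply, submatrix_apply]
  exact Fintype.sum_equiv e _ _ fun _ => rfl

/-- The Kronecker product of real psd matrices is psd (`(XᴴX) ⊗ (YᴴY) = (X ⊗ Y)ᴴ (X ⊗ Y)`). [folklore] -/
private theorem posSemidef_kronecker {p q : Type*} [Fintype p] [Fintype q] [DecidableEq p]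
    [DecidableEq q] {A : Matrix p p ℝ} {B : Matrix q q ℝ} (hA : A.PosSemidef) (hB : B.PosSemidef) :
    (A ⊗ₖ B).PosSemidef := by
  obtain ⟨X, rfl⟩ := CStarAlgebra.nonneg_iff_eq_star_mul_self.mp hA.nonneg
  obtain ⟨Y, rfl⟩ := CStarAlgebra.nonneg_iff_eq_star_mul_self.mp hB.nonneg
  rw [mul_kronecker_mul, star_eq_conjTranspose, star_eq_conjTranspose, ← conjTranspose_kronecker]
  exact posSemidef_conjTranspose_mul_self _

/-- **Kronecker products** (p07, verbatim): "the inequality `rank_psd(M ⊗ N) ≤ rank_psd(M) rank_psd(N)`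
is always true" (it can be strict, Lee–Wei–de Wolf): factors `A_i ⊗ A'_{i'}`, `B_j ⊗ B'_{j'}`, since
`⟨A ⊗ A', B ⊗ B'⟩ = ⟨A,B⟩⟨A',B'⟩`. [cite: FawziEtAl2015, §2.3 Kronecker product (p07)] -/
theorem HasPsdFactorization.kronecker {ι' κ' : Type*} {M : ι → κ → ℝ} {N : ι' → κ' → ℝ} {r s : ℕ}
    (hM : HasPsdFactorization M r) (hN : HasPsdFactorization N s) :
    HasPsdFactorization (fun (p : ι × ι') (q : κ × κ') => M p.1 q.1 * N p.2 q.2) (r * s) := by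
  obtain ⟨A, B, hA, hB, hMf⟩ := hM
  obtain ⟨C, D, hC, hD, hNf⟩ := hN
  let e : Fin (r * s) ≃ Fin r × Fin s := finProdFinEquiv.symm
  refine ⟨fun p => (A p.1 ⊗ₖ C p.2).submatrix e e, fun q => (B q.1 ⊗ₖ D q.2).submatrix e e,
    fun p => (posSemidef_submatrix_equiv e).mpr (posSemidef_kronecker (hA _) (hC _)),
    fun q => (posSemidef_submatrix_equiv e).mpr (posSemidef_kronecker (hB _) (hD _)), fun p q => ?_⟩
  change M p.1 q.1 * N p.2 q.2 = ((A p.1 ⊗ₖ C p.2).submatrix e e * (B q.1 ⊗ₖ D q.2).submatrix e e).trace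
  rw [submatrix_mul_equiv, trace_submatrix_equiv', ← mul_kronecker_mul, trace_kronecker, hMf, hNf]

/-! ### Theorem 2.12 (closedness) and Lemma 2.13 (bounded factors) -/

/-- **FGPRT Theorem 2.12** (p07, verbatim): "Let `(M^n)_{n∈ℕ}` be a sequence of nonnegative matrices
converging to `M ∈ ℝ^{p×q}_+` such that `rank_psd(M^n) ≤ k` for all `n ∈ ℕ`. Then `rank_psd(M) ≤ k`"
(Remark 2.14: `rank_psd` is lower semicontinuous; the set of matrices of psd rank `≤ k` is closed).
Proof via Lemma 2.13 (bounded factors) and compactness. [cite: FawziEtAl2015, Thm. 2.12 (p07–p08)] -/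
def FawziEtAl2015_thm212 : Prop :=
  ∀ (ι κ : Type) [Finite ι] [Finite κ] (M : ℕ → ι → κ → ℝ) (L : ι → κ → ℝ) (k : ℕ),
    (∀ n, HasPsdFactorization (M n) k) →
    (∀ i j, Filter.Tendsto (fun n => M n i j) Filter.atTop (nhds (L i j))) →
      HasPsdFactorization L k

/-- **FGPRT Lemma 2.13 (= Lemma 6.4)** (p08 / p18, verbatim): "Let `M ∈ ℝ^{p×q}_+` and assume that `M`
has a psd factorization of size `k`. Then `M` admits a psd factorization `M_{ij} = ⟨A_i, B_j⟩` of
size `k` where the factors satisfy `trace(A_i) ≤ k` and `trace(B_j) = Σ_{i=1}^p M_{ij}`" (proof p18: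
conjugate by `S^{-1/2}`, `S = Σ_i A_i`, after reducing to `S` invertible).
[cite: FawziEtAl2015, Lemma 2.13 (p08) = Lemma 6.4 (p18)] -/
def FawziEtAl2015_lemma213 : Prop :=
  ∀ (ι κ : Type) [Fintype ι] [Finite κ] (M : ι → κ → ℝ) (k : ℕ), HasPsdFactorization M k →
    ∃ (A : ι → Matrix (Fin k) (Fin k) ℝ) (B : κ → Matrix (Fin k) (Fin k) ℝ),
      (∀ i, (A i).PosSemidef) ∧ (∀ j, (B j).PosSemidef) ∧ (∀ i j, M i j = (A i * B j).trace) ∧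
      (∀ i, (A i).trace ≤ k) ∧ ∀ j, (B j).trace = ∑ i, M i j

/-! ### Discharge of `FawziEtAl2015_prop25_rank`: the symmetric vectorisation -/

/-- Splitting a sum of a SYMMETRIC function over ordered pairs into the pairs `s ≤ t`, the off-diagonal
ones counted twice (the combinatorics of `svec`: `⟨A,B⟩ = Σ_s A_ss B_ss + 2 Σ_{s<t} A_st B_st`).
[cite: FawziEtAl2015, Prop. 2.5 proof (p05, the map vec)] -/
private theorem sum_prod_eq_sum_le_weighted {k : ℕ} (f : Fin k × Fin k → ℝ)
    (hf : ∀ s t, f (t, s) = f (s, t)) :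
    ∑ p, f p = ∑ q : {p : Fin k × Fin k // p.1 ≤ p.2}, (if q.1.1 = q.1.2 then 1 else 2) * f q.1 := by
  classical
  -- the three regions `s < t`, `s = t`, `t < s`
  set Slt : Finset (Fin k × Fin k) := univ.filter fun p => p.1 < p.2 with hSlt
  set Seq : Finset (Fin k × Fin k) := univ.filter fun p => p.1 = p.2 with hSeq
  have hsplit : ∑ p, f p = (∑ p ∈ univ.filter (fun p : Fin k × Fin k => p.1 ≤ p.2), f p) +
      ∑ p ∈ univ.filter (fun p : Fin k × Fin k => ¬ p.1 ≤ p.2), f p :=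
    (sum_filter_add_sum_filter_not _ _ _).symm
  -- `t < s` region = `s < t` region by the symmetry of `f`
  have hswap : ∑ p ∈ univ.filter (fun p : Fin k × Fin k => ¬ p.1 ≤ p.2), f p = ∑ p ∈ Slt, f p := by
    refine Finset.sum_equiv (Equiv.prodComm (Fin k) (Fin k)) (fun p => ?_) (fun p _ => ?_)
    · simp [hSlt, not_le]
    · obtain ⟨s, t⟩ := p
      simpa using hf t s
  -- `s ≤ t` region = `s < t` region + diagonal
  have hle : ∑ p ∈ univ.filter (fun p : Fin k × Fin k => p.1 ≤ p.2), f p =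
      ∑ p ∈ Slt, f p + ∑ p ∈ Seq, f p := by
    rw [← sum_filter_add_sum_filter_not (univ.filter fun p : Fin k × Fin k => p.1 ≤ p.2)
      (fun p => p.1 = p.2), Finset.filter_filter, Finset.filter_filter, add_comm]
    congr 1
    · refine Finset.sum_congr (Finset.filter_congr fun p _ => ?_) fun _ _ => rfl
      constructor
      · rintro ⟨h1, h2⟩; exact lt_of_le_of_ne h1 h2
      · intro h; exact ⟨h.le, h.ne⟩
    · refine Finset.sum_congr (Finset.filter_congr fun p _ => ?_) fun _ _ => rfl
      constructor
      · rintro ⟨_, h2⟩; exact h2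
      · intro h; exact ⟨h.le, h⟩
  -- the right-hand side over the subtype, as a sum over the filter `s ≤ t`
  have hrhs : ∑ q : {p : Fin k × Fin k // p.1 ≤ p.2}, (if q.1.1 = q.1.2 then 1 else 2) * f q.1 =
      ∑ p ∈ univ.filter (fun p : Fin k × Fin k => p.1 ≤ p.2), (if p.1 = p.2 then 1 else 2) * f p := by
    rw [Finset.sum_subtype (univ.filter fun p : Fin k × Fin k => p.1 ≤ p.2) (p := fun p => p.1 ≤ p.2)
      (fun p => by simp)]
  have hrhs' : ∑ p ∈ univ.filter (fun p : Fin k × Fin k => p.1 ≤ p.2), (if p.1 = p.2 then 1 else 2) * f p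
      = ∑ p ∈ Seq, f p + 2 * ∑ p ∈ Slt, f p := by
    rw [← sum_filter_add_sum_filter_not (univ.filter fun p : Fin k × Fin k => p.1 ≤ p.2)
      (fun p => p.1 = p.2), Finset.filter_filter, Finset.filter_filter, Finset.mul_sum]
    congr 1
    · have hS : univ.filter (fun p : Fin k × Fin k => p.1 ≤ p.2 ∧ p.1 = p.2) = Seq :=
        Finset.filter_congr fun p _ => ⟨fun h => h.2, fun h => ⟨h.le, h⟩⟩
      rw [hS]
      refine Finset.sum_congr rfl fun p hp => ?_
      rw [if_pos (by simpa [hSeq] using hp), one_mul]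
    · have hS : univ.filter (fun p : Fin k × Fin k => p.1 ≤ p.2 ∧ ¬ p.1 = p.2) = Slt :=
        Finset.filter_congr fun p _ => ⟨fun h => lt_of_le_of_ne h.1 h.2, fun h => ⟨h.le, h.ne⟩⟩
      rw [hS]
      refine Finset.sum_congr rfl fun p hp => ?_
      have hne : ¬ p.1 = p.2 := ne_of_lt (by simpa [hSlt] using hp)
      rw [if_neg hne]
  rw [hsplit, hswap, hle, hrhs, hrhs']
  ring

/-- **Discharge of `FawziEtAl2015_prop25_rank`** (Proposition 2.5, `rank M ≤ C(rank_psd M + 1, 2)`): with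
symmetric `A_i, B_j`, `⟨A_i,B_j⟩ = Σ_{s≤t} w_{st} (A_i)_{st} (B_j)_{st}` (`w = 1` on the diagonal, `2` off
it), so `M = U V` factors through the `C(k+1,2)` coordinates `{(s,t) : s ≤ t}` (the printed `vec` map
with the `√2` split as `2 · 1`), whence `rank M ≤ C(k+1,2)` (`|{s ≤ t}| = |Sym2 (Fin k)|`).
[cite: FawziEtAl2015, Prop. 2.5 (p05)] -/
theorem FawziEtAl2015_prop25_rank_holds : FawziEtAl2015_prop25_rank := by
  intro ι κ _ _ M k h
  classical
  obtain ⟨A, B, hA, hB, hM⟩ := h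
  have hAs : ∀ i s t, A i t s = A i s t := fun i s t => by
    simpa using (hA i).1.apply s t
  have hBs : ∀ j s t, B j t s = B j s t := fun j s t => by
    simpa using (hB j).1.apply s t
  let T := {p : Fin k × Fin k // p.1 ≤ p.2}
  let U : Matrix ι T ℝ := fun i q => (if q.1.1 = q.1.2 then 1 else 2) * A i q.1.1 q.1.2
  let V : Matrix T κ ℝ := fun q j => B j q.1.1 q.1.2
  have hUV : M = U * V := by
    ext i j
    rw [hM i j, Matrix.mul_apply]
    have h1 : (A i * B j).trace = ∑ p : Fin k × Fin k, A i p.1 p.2 * B j p.1 p.2 := by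
      simp only [Matrix.trace, Matrix.diag_apply, Matrix.mul_apply]
      rw [← Finset.univ_product_univ, Finset.sum_product]
      refine Finset.sum_congr rfl fun s _ => Finset.sum_congr rfl fun t _ => ?_
      rw [hBs j s t]
    rw [h1, sum_prod_eq_sum_le_weighted (fun p => A i p.1 p.2 * B j p.1 p.2)
      (fun s t => by simp only; rw [hAs i s t, hBs j s t])]
    refine Finset.sum_congr rfl fun q _ => ?_
    simp only [U, V]
    ring
  have hcard : Fintype.card T = (k + 1).choose 2 := by
    rw [← Fintype.card_congr (Sym2.sortEquiv (α := Fin k)), Sym2.card, Fintype.card_fin]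
  calc M.rank = (U * V).rank := by rw [hUV]
    _ ≤ U.rank := Matrix.rank_mul_le_left _ _
    _ ≤ Fintype.card T := Matrix.rank_le_card_width _
    _ = (k + 1).choose 2 := hcard


/-- **FGPRT Proposition 2.5, first inequality, unconditional form**: a psd factorization of size `k` of a
real matrix forces `rank M ≤ C(k+1, 2)`. [cite: FawziEtAl2015, Prop. 2.5 (p05)] -/
theorem HasPsdFactorization.rank_le_choose {ι κ : Type} [Fintype ι] [Fintype κ] {M : Matrix ι κ ℝ}
    {k : ℕ} (h : HasPsdFactorization M k) : M.rank ≤ (k + 1).choose 2 :=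
  FawziEtAl2015_prop25_rank_holds ι κ M k h

/-- **FGPRT Proposition 2.5, printed form** `½√(1+8 rank M) − ½ ≤ rank_psd M`, unconditional.
[cite: FawziEtAl2015, Prop. 2.5 (p05, eq. (1))] -/
theorem HasPsdFactorization.sqrt_rank_le {ι κ : Type} [Fintype ι] [Fintype κ] (M : Matrix ι κ ℝ)
    {k : ℕ} (h : HasPsdFactorization M k) : Real.sqrt (1 + 8 * (M.rank : ℝ)) / 2 - 1 / 2 ≤ k :=
  FawziEtAl2015_prop25_rank.sqrt_form FawziEtAl2015_prop25_rank_holds M h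


/-! ### Discharge of `FawziEtAl2015_thm210`: compressing a psd factorization to a subspace -/

section Thm210

variable {k m : ℕ} {K : Submodule ℝ (EuclideanSpace ℝ (Fin k))}

/-- The `k × m` matrix whose columns are the vectors of an orthonormal basis of a subspace
`K ⊆ ℝ^k`. [folklore] -/
private def onbMatrix (b : OrthonormalBasis (Fin m) ℝ K) : Matrix (Fin k) (Fin m) ℝ :=
  Matrix.of fun s a => (b a : EuclideanSpace ℝ (Fin k)) s

/-- `QᵀQ = I` for the matrix `Q` of an orthonormal basis. [folklore] -/
private theorem onbMatrix_transpose_mul_self (b : OrthonormalBasis (Fin m) ℝ K) :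
    (onbMatrix b)ᵀ * onbMatrix b = 1 := by
  ext a c
  have h := orthonormal_iff_ite.mp b.orthonormal a c
  rw [Submodule.coe_inner] at h
  have h' : ∑ s, (b a : EuclideanSpace ℝ (Fin k)) s * (b c : EuclideanSpace ℝ (Fin k)) s =
      if a = c then 1 else 0 := by
    simpa [PiLp.inner_apply, mul_comm] using h
  rw [Matrix.mul_apply, Matrix.one_apply, ← h']
  simp only [onbMatrix, transpose_apply, of_apply]

/-- `Q Qᵀ v = v` for `v` in the subspace (`Q Qᵀ` is the orthogonal projection onto `K`). [folklore] -/
private theorem onbMatrix_proj_mulVec (b : OrthonormalBasis (Fin m) ℝ K)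
    {v : EuclideanSpace ℝ (Fin k)} (hv : v ∈ K) :
    (onbMatrix b * (onbMatrix b)ᵀ) *ᵥ v.ofLp = v.ofLp := by
  classical
  funext s
  have h := b.sum_repr' ⟨v, hv⟩
  have h2 := congrArg (fun w : K => (w : EuclideanSpace ℝ (Fin k)) s) h
  simp only [Submodule.coe_sum, Submodule.coe_smul, Submodule.coe_inner] at h2
  have h3 : ∑ a, (inner ℝ (b a : EuclideanSpace ℝ (Fin k)) v) *
      (b a : EuclideanSpace ℝ (Fin k)) s = v s := by
    simpa [WithLp.ofLp_sum, Finset.sum_apply, smul_eq_mul] using h2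
  rw [← mulVec_mulVec]
  change _ = v s
  rw [← h3]
  simp only [mulVec, dotProduct, onbMatrix, transpose_apply, of_apply]
  refine sum_congr rfl fun a _ => ?_
  rw [mul_comm]
  congr 1
  simp [PiLp.inner_apply, mul_comm]

/-- `Q Qᵀ A = A` when the columns of `A` lie in `K`. [folklore] -/
private theorem onbMatrix_proj_mul (b : OrthonormalBasis (Fin m) ℝ K) {A : Matrix (Fin k) (Fin k) ℝ}
    (hrange : ∀ w : Fin k → ℝ, WithLp.toLp 2 (A *ᵥ w) ∈ K) :
    onbMatrix b * (onbMatrix b)ᵀ * A = A := by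
  classical
  ext s t
  have h := congrFun (onbMatrix_proj_mulVec b (hrange (Pi.single t 1))) s
  simp only [mulVec_mulVec] at h
  simpa [Matrix.mulVec_single_one] using h

/-- Compression to `K`: `Tr(QᵀAQ · QᵀBQ) = Tr(A B)` when `A` is symmetric with columns in `K`. [folklore] -/
private theorem trace_compress (b : OrthonormalBasis (Fin m) ℝ K) {A B : Matrix (Fin k) (Fin k) ℝ}
    (hA : Aᵀ = A) (hrange : ∀ w : Fin k → ℝ, WithLp.toLp 2 (A *ᵥ w) ∈ K) :
    ((onbMatrix b)ᵀ * A * onbMatrix b * ((onbMatrix b)ᵀ * B * onbMatrix b)).trace = (A * B).trace := by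
  set Q := onbMatrix b with hQ
  have hPA : Q * Qᵀ * A = A := onbMatrix_proj_mul b hrange
  have hAP : A * (Q * Qᵀ) = A := by
    have h := congrArg transpose hPA
    rw [transpose_mul, transpose_mul, transpose_transpose, hA] at h
    exact h
  calc (Qᵀ * A * Q * (Qᵀ * B * Q)).trace = ((Qᵀ * A * Q * Qᵀ * B) * Q).trace := by
        simp only [Matrix.mul_assoc]
    _ = (Q * (Qᵀ * A * Q * Qᵀ * B)).trace := Matrix.trace_mul_comm _ _
    _ = ((Q * Qᵀ * A) * (Q * Qᵀ) * B).trace := by simp only [Matrix.mul_assoc]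
    _ = (A * B).trace := by rw [hPA, hAP]

end Thm210

/-- **Discharge of `FawziEtAl2015_thm210`** (Theorem 2.10, `rank_psd [P 0; Q R] ≥ rank_psd P + rank_psd R`),
following the printed proof: from `⟨A_i, B̂_j⟩ = 0`, `A_i B̂_j = 0` (Prop. 2.1); with `G = ⋂_j ker B̂_j`
(the orthogonal complement of `F = Σ_j range B̂_j`), the `A_i` have range in `G` and the `B̂_j` in `Gᗮ`,
so compressing `(A_i, B_j)` to `G` by an orthonormal basis (`X ↦ QᵀXQ`) factorizes `P` in size
`dim G` and compressing `(Â_i, B̂_j)` to `Gᗮ` factorizes `R` in size `dim Gᗮ = k − dim G`.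
[cite: FawziEtAl2015, Thm. 2.10 (p07)] -/
theorem FawziEtAl2015_thm210_holds : FawziEtAl2015_thm210 := by
  intro ι₁ ι₂ κ₁ κ₂ _ _ _ _ P Q R k h
  classical
  obtain ⟨A, B, hA, hB, hM⟩ := h
  have hP : ∀ i j, P i j = (A (Sum.inl i) * B (Sum.inl j)).trace := fun i j => by
    simpa using hM (Sum.inl i) (Sum.inl j)
  have hR : ∀ i j, R i j = (A (Sum.inr i) * B (Sum.inr j)).trace := fun i j => by
    simpa using hM (Sum.inr i) (Sum.inr j)
  have hAB : ∀ i j, A (Sum.inl i) * B (Sum.inr j) = 0 := fun i j =>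
    mul_eq_zero_of_posSemidef_trace_eq_zero (hA _) (hB _) (by simpa using (hM (Sum.inl i) (Sum.inr j)).symm)
  have hAt : ∀ i, (A i)ᵀ = A i := fun i => by
    simpa [conjTranspose_eq_transpose_of_trivial] using (hA i).1.eq
  have hBt : ∀ j, (B j)ᵀ = B j := fun j => by
    simpa [conjTranspose_eq_transpose_of_trivial] using (hB j).1.eq
  have hBA : ∀ i j, B (Sum.inr j) * A (Sum.inl i) = 0 := fun i j => by
    rw [← hBt, ← hAt, ← transpose_mul, hAB, transpose_zero]
  -- `G = ⋂_j ker B̂_j`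
  let G : Submodule ℝ (EuclideanSpace ℝ (Fin k)) :=
    { carrier := {v | ∀ j, B (Sum.inr j) *ᵥ v.ofLp = 0}
      add_mem' := fun {u v} hu hv j => by
        simp only [Set.mem_setOf_eq] at hu hv ⊢
        rw [WithLp.ofLp_add, mulVec_add, hu j, hv j, add_zero]
      zero_mem' := fun j => by simp
      smul_mem' := fun c v hv j => by
        simp only [Set.mem_setOf_eq] at hv ⊢
        rw [WithLp.ofLp_smul, mulVec_smul, hv j, smul_zero] }
  have hAG : ∀ i (w : Fin k → ℝ), WithLp.toLp 2 (A (Sum.inl i) *ᵥ w) ∈ G := fun i w j => by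
    change B (Sum.inr j) *ᵥ (WithLp.toLp 2 (A (Sum.inl i) *ᵥ w)).ofLp = 0
    rw [WithLp.ofLp_toLp, mulVec_mulVec, hBA, zero_mulVec]
  have hBG : ∀ j (w : Fin k → ℝ), WithLp.toLp 2 (B (Sum.inr j) *ᵥ w) ∈ Gᗮ := fun j w => by
    rw [Submodule.mem_orthogonal]
    intro u hu
    have hu' : B (Sum.inr j) *ᵥ u.ofLp = 0 := hu j
    have hinner : inner ℝ u (WithLp.toLp 2 (B (Sum.inr j) *ᵥ w)) = u.ofLp ⬝ᵥ (B (Sum.inr j) *ᵥ w) := by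
      simp [PiLp.inner_apply, dotProduct, mul_comm]
    rw [hinner, dotProduct_mulVec, ← mulVec_transpose, hBt, hu', zero_dotProduct]
  -- orthonormal bases and sizes
  let bG := stdOrthonormalBasis ℝ G
  let bF := stdOrthonormalBasis ℝ Gᗮ
  have hdim : Module.finrank ℝ G + Module.finrank ℝ Gᗮ = k := by
    rw [Submodule.finrank_add_finrank_orthogonal, finrank_euclideanSpace, Fintype.card_fin]
  refine ⟨Module.finrank ℝ G, Module.finrank ℝ Gᗮ, hdim.le, ?_, ?_⟩
  · refine ⟨fun i => (onbMatrix bG)ᵀ * A (Sum.inl i) * onbMatrix bG,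
      fun j => (onbMatrix bG)ᵀ * B (Sum.inl j) * onbMatrix bG, fun i => ?_, fun j => ?_, fun i j => ?_⟩
    · simpa [conjTranspose_eq_transpose_of_trivial] using (hA (Sum.inl i)).conjTranspose_mul_mul_same (onbMatrix bG)
    · simpa [conjTranspose_eq_transpose_of_trivial] using (hB (Sum.inl j)).conjTranspose_mul_mul_same (onbMatrix bG)
    · rw [hP i j, trace_compress bG (hAt _) (hAG i)]
  · refine ⟨fun i => (onbMatrix bF)ᵀ * A (Sum.inr i) * onbMatrix bF,
      fun j => (onbMatrix bF)ᵀ * B (Sum.inr j) * onbMatrix bF, fun i => ?_, fun j => ?_, fun i j => ?_⟩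
    · simpa [conjTranspose_eq_transpose_of_trivial] using (hA (Sum.inr i)).conjTranspose_mul_mul_same (onbMatrix bF)
    · simpa [conjTranspose_eq_transpose_of_trivial] using (hB (Sum.inr j)).conjTranspose_mul_mul_same (onbMatrix bF)
    · rw [hR i j, Matrix.trace_mul_comm (A (Sum.inr i)), Matrix.trace_mul_comm ((onbMatrix bF)ᵀ * A (Sum.inr i) * _),
        trace_compress bF (hBt _) (hBG j)]


/-! ### Discharge of `FawziEtAl2015_lemma213`: trace-normalised factors -/

/-- `Tr(P X Pᵀ) = Tr(X)` for the selection matrix of an injective map. [folklore] -/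
private theorem trace_padMatrix_eq {m m' : ℕ} {e : Fin m → Fin m'} (he : Function.Injective e)
    (X : Matrix (Fin m) (Fin m) ℝ) : (padMatrix e X).trace = X.trace := by
  rw [padMatrix_apply, Matrix.trace_mul_cycle, selMatrix_transpose_mul_self he, Matrix.one_mul]

/-- **Discharge of `FawziEtAl2015_lemma213`** (Lemma 2.13 = Lemma 6.4), following the printed proof:
with `S = Σ_i A_i`, first compress the factorization to `G = (ker S)ᗮ` (all `A_i` vanish on `ker S`),
where `S' = QᵀSQ` is positive definite; write `S' = RᵀR` and conjugate, `A_i ↦ R^{-ᵀ}A_iR^{-1}`,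
`B_j ↦ R B_j Rᵀ` (the printed `S^{-1/2} · S^{-1/2}` up to an orthogonal change, same traces), so that
`Σ_i A_i = I`, whence `Tr A_i ≤ Tr I ≤ k` and `Tr B_j = Tr(S B_j) = Σ_i M_{ij}`; finally pad with zeros
back to size `k`. [cite: FawziEtAl2015, Lemma 2.13 (p08) = Lemma 6.4 (p18, proof)] -/
theorem FawziEtAl2015_lemma213_holds : FawziEtAl2015_lemma213 := by
  intro ι κ _ _ M k h
  classical
  obtain ⟨A, B, hA, hB, hM⟩ := h
  have hAt : ∀ i, (A i)ᵀ = A i := fun i => by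
    simpa [conjTranspose_eq_transpose_of_trivial] using (hA i).1.eq
  -- `S = Σ_i A_i` and its kernel
  set S : Matrix (Fin k) (Fin k) ℝ := ∑ i, A i with hSdef
  have hSpsd : S.PosSemidef := posSemidef_sum _ fun i _ => hA i
  have hkerA : ∀ (u : Fin k → ℝ), S *ᵥ u = 0 → ∀ i, A i *ᵥ u = 0 := by
    intro u hu i
    have hsum : ∑ i', u ⬝ᵥ (A i' *ᵥ u) = 0 := by
      rw [← dotProduct_sum, ← Matrix.sum_mulVec, ← hSdef, hu, dotProduct_zero]
    have hnn : ∀ i', 0 ≤ u ⬝ᵥ (A i' *ᵥ u) := fun i' => by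
      simpa using (posSemidef_iff_dotProduct_mulVec.mp (hA i')).2 u
    have h0 : u ⬝ᵥ (A i *ᵥ u) = 0 :=
      le_antisymm (by rw [← hsum]; exact single_le_sum (fun i' _ => hnn i') (mem_univ i)) (hnn i)
    have h0' : star u ⬝ᵥ (A i *ᵥ u) = 0 := by simpa using h0
    exact (hA i).dotProduct_mulVec_zero_iff u |>.mp h0'
  let kerS : Submodule ℝ (EuclideanSpace ℝ (Fin k)) :=
    { carrier := {v | S *ᵥ v.ofLp = 0}
      add_mem' := fun {u v} hu hv => by
        simp only [Set.mem_setOf_eq] at hu hv ⊢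
        rw [WithLp.ofLp_add, mulVec_add, hu, hv, add_zero]
      zero_mem' := by simp
      smul_mem' := fun c v hv => by
        simp only [Set.mem_setOf_eq] at hv ⊢
        rw [WithLp.ofLp_smul, mulVec_smul, hv, smul_zero] }
  let G : Submodule ℝ (EuclideanSpace ℝ (Fin k)) := kerSᗮ
  -- the `A_i` have range in `G`
  have hAG : ∀ i (w : Fin k → ℝ), WithLp.toLp 2 (A i *ᵥ w) ∈ G := fun i w => by
    rw [Submodule.mem_orthogonal]
    intro u hu
    have hu' : A i *ᵥ u.ofLp = 0 := hkerA _ hu i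
    have hinner : inner ℝ u (WithLp.toLp 2 (A i *ᵥ w)) = u.ofLp ⬝ᵥ (A i *ᵥ w) := by
      simp [PiLp.inner_apply, dotProduct, mul_comm]
    rw [hinner, dotProduct_mulVec, ← mulVec_transpose, hAt, hu', zero_dotProduct]
  -- compression to `G`
  let bG := stdOrthonormalBasis ℝ G
  set m := Module.finrank ℝ G with hmdef
  have hmk : m ≤ k := by
    have h := Submodule.finrank_le G
    rwa [finrank_euclideanSpace, Fintype.card_fin] at h
  set Qm : Matrix (Fin k) (Fin m) ℝ := onbMatrix bG with hQm
  have hQtQ : Qmᵀ * Qm = 1 := onbMatrix_transpose_mul_self bG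
  have hQmem : ∀ v : Fin m → ℝ, WithLp.toLp 2 (Qm *ᵥ v) ∈ G := fun v => by
    have hrepr : WithLp.toLp 2 (Qm *ᵥ v) = ∑ a, v a • (bG a : EuclideanSpace ℝ (Fin k)) := by
      ext s
      simp [hQm, onbMatrix, mulVec, dotProduct, WithLp.ofLp_sum, Finset.sum_apply, mul_comm]
    rw [hrepr]
    exact Submodule.sum_mem _ fun a _ => Submodule.smul_mem _ _ (bG a).2
  let A' : ι → Matrix (Fin m) (Fin m) ℝ := fun i => Qmᵀ * A i * Qm
  let B' : κ → Matrix (Fin m) (Fin m) ℝ := fun j => Qmᵀ * B j * Qm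
  have hA' : ∀ i, (A' i).PosSemidef := fun i => by
    simpa [A', conjTranspose_eq_transpose_of_trivial] using (hA i).conjTranspose_mul_mul_same Qm
  have hB' : ∀ j, (B' j).PosSemidef := fun j => by
    simpa [B', conjTranspose_eq_transpose_of_trivial] using (hB j).conjTranspose_mul_mul_same Qm
  have hM' : ∀ i j, M i j = (A' i * B' j).trace := fun i j => by
    rw [hM i j]; exact (trace_compress bG (hAt i) (hAG i)).symm
  -- `S' = Qᵀ S Q = Σ_i A'_i` is positive definite
  set S' : Matrix (Fin m) (Fin m) ℝ := ∑ i, A' i with hS'def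
  have hS'eq : S' = Qmᵀ * S * Qm := by
    rw [hS'def, hSdef, Matrix.mul_sum, Matrix.sum_mul]
  have hS'psd : S'.PosSemidef := posSemidef_sum _ fun i _ => hA' i
  have hS'pd : S'.PosDef := by
    refine posDef_iff_dotProduct_mulVec.mpr ⟨hS'psd.1, fun x hx => lt_of_le_of_ne ?_ ?_⟩
    · exact (posSemidef_iff_dotProduct_mulVec.mp hS'psd).2 x
    · intro h0
      -- `xᵀ S' x = (Qx)ᵀ S (Qx) = 0 ⇒ S (Qx) = 0 ⇒ Qx ∈ ker S ∩ (ker S)ᗮ = 0 ⇒ x = QᵀQx = 0`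
      have h1 : star (Qm *ᵥ x) ⬝ᵥ (S *ᵥ (Qm *ᵥ x)) = 0 := by
        have hq : (Qm *ᵥ x) ⬝ᵥ (S *ᵥ (Qm *ᵥ x)) = x ⬝ᵥ ((Qmᵀ * S * Qm) *ᵥ x) := by
          rw [← mulVec_mulVec, ← mulVec_mulVec, dotProduct_mulVec x Qmᵀ, vecMul_transpose]
        have h0' : x ⬝ᵥ (S' *ᵥ x) = 0 := by simpa using h0.symm
        rw [star_trivial, hq, ← hS'eq, h0']
      have h2 : S *ᵥ (Qm *ᵥ x) = 0 := (hSpsd.dotProduct_mulVec_zero_iff _).mp h1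
      have hmemK : WithLp.toLp 2 (Qm *ᵥ x) ∈ kerS := by
        change S *ᵥ (WithLp.toLp 2 (Qm *ᵥ x)).ofLp = 0
        simpa using h2
      have hmemG : WithLp.toLp 2 (Qm *ᵥ x) ∈ G := hQmem x
      have hzero : WithLp.toLp 2 (Qm *ᵥ x) = 0 := by
        have h := (Submodule.mem_orthogonal kerS _).mp hmemG _ hmemK
        exact inner_self_eq_zero.mp h
      have hQx : Qm *ᵥ x = 0 := by
        have h := congrArg WithLp.ofLp hzero
        simpa using h
      apply hx
      calc x = (Qmᵀ * Qm) *ᵥ x := by rw [hQtQ, one_mulVec]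
        _ = 0 := by rw [← mulVec_mulVec, hQx, mulVec_zero]
  -- `S' = Rᵀ R` with `R` invertible; conjugate by `L = R⁻¹`
  obtain ⟨Rm, hRm⟩ := CStarAlgebra.nonneg_iff_eq_star_mul_self.mp hS'psd.nonneg
  have hRt : star Rm = Rmᵀ := by rw [star_eq_conjTranspose, conjTranspose_eq_transpose_of_trivial]
  rw [hRt] at hRm
  have hRdet : IsUnit Rm.det := by
    have hd : S'.det ≠ 0 := ne_of_gt hS'pd.det_pos
    rw [hRm, det_mul, det_transpose] at hd
    exact isUnit_iff_ne_zero.mpr (fun h => hd (by rw [h, mul_zero]))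
  have hRRinv : Rm * Rm⁻¹ = 1 := Matrix.mul_nonsing_inv Rm hRdet
  have hRinvR : Rm⁻¹ * Rm = 1 := Matrix.nonsing_inv_mul Rm hRdet
  let A'' : ι → Matrix (Fin m) (Fin m) ℝ := fun i => (Rm⁻¹)ᵀ * A' i * Rm⁻¹
  let B'' : κ → Matrix (Fin m) (Fin m) ℝ := fun j => Rm * B' j * Rmᵀ
  have hA'' : ∀ i, (A'' i).PosSemidef := fun i => by
    simpa [A'', conjTranspose_eq_transpose_of_trivial] using (hA' i).conjTranspose_mul_mul_same Rm⁻¹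
  have hB'' : ∀ j, (B'' j).PosSemidef := fun j => by
    simpa [B'', conjTranspose_eq_transpose_of_trivial] using (hB' j).mul_mul_conjTranspose_same Rm
  have hM'' : ∀ i j, M i j = (A'' i * B'' j).trace := fun i j => by
    rw [hM' i j]
    symm
    calc ((Rm⁻¹)ᵀ * A' i * Rm⁻¹ * (Rm * B' j * Rmᵀ)).trace
        = ((Rm⁻¹)ᵀ * A' i * (Rm⁻¹ * Rm) * B' j * Rmᵀ).trace := by simp only [Matrix.mul_assoc]
      _ = (Rmᵀ * (Rm⁻¹)ᵀ * (A' i * B' j)).trace := by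
          rw [hRinvR, Matrix.mul_one, Matrix.trace_mul_cycle]
          simp only [Matrix.mul_assoc]
      _ = (A' i * B' j).trace := by
          rw [← transpose_mul, hRinvR, transpose_one, Matrix.one_mul]
  have hsumA'' : ∑ i, A'' i = 1 := by
    have h : ∑ i, A'' i = (Rm⁻¹)ᵀ * S' * Rm⁻¹ := by
      rw [hS'def, Matrix.mul_sum, Matrix.sum_mul]
    rw [h, hRm]
    calc (Rm⁻¹)ᵀ * (Rmᵀ * Rm) * Rm⁻¹ = (Rm * Rm⁻¹)ᵀ * (Rm * Rm⁻¹) := by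
          rw [transpose_mul]; simp only [Matrix.mul_assoc]
      _ = 1 := by rw [hRRinv, transpose_one, Matrix.one_mul]
  have htrA'' : ∀ i, (A'' i).trace ≤ k := fun i => by
    have h1 : (A'' i).trace ≤ (∑ i', A'' i').trace := by
      rw [trace_sum]
      exact single_le_sum (f := fun i' => (A'' i').trace) (fun i' _ => (hA'' i').trace_nonneg) (mem_univ i)
    rw [hsumA'', trace_one, Fintype.card_fin] at h1
    exact h1.trans (by exact_mod_cast hmk)
  have htrB'' : ∀ j, (B'' j).trace = ∑ i, M i j := fun j => by
    calc (B'' j).trace = (Rmᵀ * Rm * B' j).trace := by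
          simp only [B'']
          rw [Matrix.trace_mul_cycle, Matrix.mul_assoc]
      _ = (∑ i, A' i * B' j).trace := by rw [← hRm, hS'def, Matrix.sum_mul]
      _ = ∑ i, M i j := by rw [trace_sum]; exact sum_congr rfl fun i _ => (hM' i j).symm
  -- pad back to size `k`
  have hinj : Function.Injective (Fin.castLE hmk) := Fin.castLE_injective hmk
  refine ⟨fun i => padMatrix (Fin.castLE hmk) (A'' i), fun j => padMatrix (Fin.castLE hmk) (B'' j),
    fun i => posSemidef_padMatrix (hA'' i), fun j => posSemidef_padMatrix (hB'' j), fun i j => ?_,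
    fun i => ?_, fun j => ?_⟩
  · rw [trace_padMatrix_mul_padMatrix hinj, ← hM'' i j]
  · rw [trace_padMatrix_eq hinj]; exact htrA'' i
  · rw [trace_padMatrix_eq hinj]; exact htrB'' j


section Thm212

open Filter Topology

/-! ### Discharge of `FawziEtAl2015_thm212`: matrices of psd rank `≤ k` form a closed set -/

/-- Entries of a real psd matrix are bounded by its trace (`A_{st}² ≤ A_{ss}A_{tt} ≤ ((A_{ss}+A_{tt})/2)²
≤ (Tr A)²`). [folklore] -/
private theorem abs_apply_le_trace_of_posSemidef {k : ℕ} {A : Matrix (Fin k) (Fin k) ℝ}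
    (hA : A.PosSemidef) (s t : Fin k) : |A s t| ≤ A.trace := by
  have hsymm : A t s = A s t := by simpa using hA.1.apply s t
  have hdiag : ∀ u, 0 ≤ A u u := fun u => by
    simpa [Matrix.mulVec_single_one, single_dotProduct, Matrix.col_apply] using
      (posSemidef_iff_dotProduct_mulVec.mp hA).2 (Pi.single u 1)
  have hminor : A s t * A s t ≤ A s s * A t t := by
    have h := (hA.submatrix ![s, t]).det_nonneg
    rw [Matrix.det_fin_two] at h
    simp only [submatrix_apply, Matrix.cons_val_zero, Matrix.cons_val_one] at h
    rw [hsymm] at h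
    linarith
  have htr : A.trace = ∑ u, A u u := rfl
  have hle : ∀ u, A u u ≤ A.trace := fun u => by
    rw [htr]; exact single_le_sum (f := fun u => A u u) (fun u _ => hdiag u) (mem_univ u)
  have htr0 : 0 ≤ A.trace := (hdiag s).trans (hle s)
  have hsq : A s t * A s t ≤ A.trace * A.trace := by
    have h1 : A s s * A t t ≤ ((A s s + A t t) / 2) * ((A s s + A t t) / 2) := by
      nlinarith [sq_nonneg (A s s - A t t)]
    have h2 : (A s s + A t t) / 2 ≤ A.trace := by linarith [hle s, hle t]
    have h3 : 0 ≤ (A s s + A t t) / 2 := by linarith [hdiag s, hdiag t]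
    calc A s t * A s t ≤ A s s * A t t := hminor
      _ ≤ ((A s s + A t t) / 2) * ((A s s + A t t) / 2) := h1
      _ ≤ A.trace * A.trace := mul_le_mul h2 h2 h3 htr0
  exact abs_le_of_sq_le_sq' (by nlinarith [hsq]) htr0 |> fun h => abs_le.mpr h

/-- **Discharge of `FawziEtAl2015_thm212`** (Theorem 2.12 / Remark 2.14: the set of matrices with a psd
factorization of size `k` is closed), following the printed proof: normalise the factorizations of the
`M^n` by Lemma 2.13 (`Tr A_i^n ≤ k`, `Tr B_j^n = Σ_i M^n_{ij}`, bounded since convergent), extract a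
convergent subsequence of the bounded sequence of factor tuples (Bolzano–Weierstrass), and pass to the
limit: limits of psd matrices are psd and `⟨A_i, B_j⟩ = lim M^{φ(n)}_{ij} = M_{ij}`.
[cite: FawziEtAl2015, Thm. 2.12 (p07–p08)] -/
theorem FawziEtAl2015_thm212_holds : FawziEtAl2015_thm212 := by
  intro ι κ _ _ M L k hfac hconv
  classical
  cases nonempty_fintype ι
  cases nonempty_fintype κ
  choose A B hA hB hM htrA htrB using fun n => FawziEtAl2015_lemma213_holds ι κ (M n) k (hfac n)
  -- the sequence of factor tuples in a finite-dimensional normed space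
  let F : ℕ → (ι → Fin k → Fin k → ℝ) × (κ → Fin k → Fin k → ℝ) :=
    fun n => (fun i s t => A n i s t, fun j s t => B n j s t)
  -- bounds: `|A^n_i st| ≤ Tr A^n_i ≤ k`, `|B^n_j st| ≤ Tr B^n_j = Σ_i M^n_ij ≤ C_j`
  have hbddB : ∀ j, ∃ C, ∀ n, (B n j).trace ≤ C := by
    intro j
    have ht : Tendsto (fun n => ∑ i, M n i j) atTop (𝓝 (∑ i, L i j)) :=
      tendsto_finsetSum _ fun i _ => hconv i j
    obtain ⟨C, hC⟩ := ht.bddAbove_range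
    exact ⟨C, fun n => by rw [htrB n j]; exact hC ⟨n, rfl⟩⟩
  choose C hC using hbddB
  set R : ℝ := k + ∑ j, |C j| with hR
  have hR0 : 0 ≤ R := by positivity
  have hAR : ∀ n i s t, |A n i s t| ≤ R := fun n i s t => by
    calc |A n i s t| ≤ (A n i).trace := abs_apply_le_trace_of_posSemidef (hA n i) s t
      _ ≤ k := htrA n i
      _ ≤ R := by rw [hR]; exact le_add_of_nonneg_right (sum_nonneg fun j _ => abs_nonneg _)
  have hBR : ∀ n j s t, |B n j s t| ≤ R := fun n j s t => by
    calc |B n j s t| ≤ (B n j).trace := abs_apply_le_trace_of_posSemidef (hB n j) s t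
      _ ≤ C j := hC j n
      _ ≤ |C j| := le_abs_self _
      _ ≤ ∑ j', |C j'| := single_le_sum (f := fun j' => |C j'|) (fun j' _ => abs_nonneg _) (mem_univ j)
      _ ≤ R := by rw [hR]; exact le_add_of_nonneg_left (Nat.cast_nonneg k)
  have hmem : ∀ n, F n ∈ Metric.closedBall (0 : (ι → Fin k → Fin k → ℝ) × (κ → Fin k → Fin k → ℝ)) R := by
    intro n
    rw [Metric.mem_closedBall, dist_zero_right, Prod.norm_def, max_le_iff]
    refine ⟨?_, ?_⟩
    · refine (pi_norm_le_iff_of_nonneg hR0).mpr fun i => (pi_norm_le_iff_of_nonneg hR0).mpr fun s =>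
        (pi_norm_le_iff_of_nonneg hR0).mpr fun t => ?_
      simpa [F, Real.norm_eq_abs] using hAR n i s t
    · refine (pi_norm_le_iff_of_nonneg hR0).mpr fun j => (pi_norm_le_iff_of_nonneg hR0).mpr fun s =>
        (pi_norm_le_iff_of_nonneg hR0).mpr fun t => ?_
      simpa [F, Real.norm_eq_abs] using hBR n j s t
  obtain ⟨Flim, -, φ, hφ, hlim⟩ := tendsto_subseq_of_bounded Metric.isBounded_closedBall hmem
  -- coordinatewise convergence along the subsequence
  have hA_t : ∀ i s t, Tendsto (fun n => A (φ n) i s t) atTop (𝓝 (Flim.1 i s t)) := by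
    intro i s t
    have h1 : Tendsto (fun n => (F (φ n)).1) atTop (𝓝 Flim.1) := (continuous_fst.tendsto _).comp hlim
    have h2 := ((continuous_apply t).tendsto _).comp
      ((((continuous_apply s).tendsto _).comp (((continuous_apply i).tendsto _).comp h1)))
    simpa [F, Function.comp_def] using h2
  have hB_t : ∀ j s t, Tendsto (fun n => B (φ n) j s t) atTop (𝓝 (Flim.2 j s t)) := by
    intro j s t
    have h1 : Tendsto (fun n => (F (φ n)).2) atTop (𝓝 Flim.2) := (continuous_snd.tendsto _).comp hlim
    have h2 := ((continuous_apply t).tendsto _).comp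
      ((((continuous_apply s).tendsto _).comp (((continuous_apply j).tendsto _).comp h1)))
    simpa [F, Function.comp_def] using h2
  -- limits of psd matrices are psd
  have hpsd_lim : ∀ (X : ℕ → Matrix (Fin k) (Fin k) ℝ) (Y : Fin k → Fin k → ℝ),
      (∀ n, (X n).PosSemidef) → (∀ s t, Tendsto (fun n => X n s t) atTop (𝓝 (Y s t))) →
      (Matrix.of Y).PosSemidef := by
    intro X Y hX hY
    refine posSemidef_iff_dotProduct_mulVec.mpr ⟨?_, fun x => ?_⟩
    · ext s t
      rw [conjTranspose_apply, star_trivial, of_apply, of_apply]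
      have hsymm : ∀ n, X n t s = X n s t := fun n => by simpa using (hX n).1.apply s t
      exact tendsto_nhds_unique (hY t s) (by simpa [hsymm] using hY s t)
    · have hq : Tendsto (fun n => star x ⬝ᵥ (X n *ᵥ x)) atTop (𝓝 (star x ⬝ᵥ (Matrix.of Y *ᵥ x))) := by
        simp only [dotProduct, mulVec, star_trivial, of_apply]
        exact tendsto_finsetSum _ fun s _ => (tendsto_const_nhds.mul
          (tendsto_finsetSum _ fun t _ => (hY s t).mul tendsto_const_nhds))
      exact ge_of_tendsto' hq fun n => (posSemidef_iff_dotProduct_mulVec.mp (hX n)).2 x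
  refine ⟨fun i => Matrix.of (Flim.1 i), fun j => Matrix.of (Flim.2 j),
    fun i => hpsd_lim (fun n => A (φ n) i) (Flim.1 i) (fun n => hA _ _) (hA_t i),
    fun j => hpsd_lim (fun n => B (φ n) j) (Flim.2 j) (fun n => hB _ _) (hB_t j), fun i j => ?_⟩
  -- `L_ij = lim M^{φ n}_ij = lim Tr(A^{φ n}_i B^{φ n}_j) = Tr(A_i B_j)`
  have h1 : Tendsto (fun n => M (φ n) i j) atTop (𝓝 (L i j)) := (hconv i j).comp hφ.tendsto_atTop
  have h2 : Tendsto (fun n => M (φ n) i j) atTop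
      (𝓝 ((Matrix.of (Flim.1 i) * Matrix.of (Flim.2 j)).trace)) := by
    have heq : ∀ n, M (φ n) i j = ∑ s, ∑ t, A (φ n) i s t * B (φ n) j t s := fun n => by
      rw [hM (φ n) i j]; simp only [Matrix.trace, diag_apply, mul_apply]
    simp only [heq, Matrix.trace, diag_apply, mul_apply, of_apply]
    exact tendsto_finsetSum _ fun s _ => tendsto_finsetSum _ fun t _ => (hA_t i s t).mul (hB_t j t s)
  exact tendsto_nhds_unique h1 h2

end Thm212

/-! ### Discharge of `FawziEtAl2015_prop28`: ranks one and two (Cohen–Rothblum) -/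

section Prop28

variable {ι κ : Type*}

/-- A nonzero real matrix has positive rank (a nonzero column is a nonzero vector of the column
space). [folklore] -/
private theorem rank_pos_of_ne_zero [Fintype ι] [Fintype κ] {M : Matrix ι κ ℝ} (hM : M ≠ 0) :
    0 < M.rank := by
  classical
  obtain ⟨i, j, hij⟩ : ∃ i j, M i j ≠ 0 := by
    by_contra h
    push Not at h
    exact hM (Matrix.ext fun i j => by rw [h i j]; rfl)
  unfold Matrix.rank
  refine Module.finrank_pos_iff_exists_ne_zero.mpr
    ⟨⟨M.mulVecLin (Pi.single j 1), LinearMap.mem_range_self _ _⟩, fun h => hij ?_⟩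
  have h' := congrArg (fun v : LinearMap.range M.mulVecLin => (v : ι → ℝ) i) h
  simpa [Matrix.mulVec, dotProduct, Pi.single_apply] using h'

/-- **Cohen–Rothblum for rank `≤ 2`, core step** (the argument behind "if `rank(M) = 2` then
`rank_+(M) = 2`", [FGPRT, Prop. 2.8 proof, citing Cohen–Rothblum 1993]): if the rows of a nonnegative
`M` are `α_i b⁰ + β_i b¹` and `Σ_j b¹_j ≠ 0`, normalise the nonzero rows by their coordinate sums; they
then lie on the affine line `base + t·dir` (`base = b¹/Σb¹`, `dir = b⁰ − (Σb⁰/Σb¹) b¹`) at parameters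
`t_i`, and the two normalised rows with extreme parameters `t_min, t_max` are nonnegative generators:
every row is a nonnegative combination of them. [cite: FawziEtAl2015, Prop. 2.8 (p06)] -/
private theorem exists_nonnegFactorization_two_aux [Fintype ι] [Fintype κ] {M : Matrix ι κ ℝ}
    (hM : ∀ i j, 0 ≤ M i j) (a0 a1 : ι → ℝ) (b0 b1 : κ → ℝ)
    (hfac : ∀ i j, M i j = a0 i * b0 j + a1 i * b1 j) (hL1 : ∑ j, b1 j ≠ 0) :
    ∃ (U : ι → Fin 2 → ℝ) (V : Fin 2 → κ → ℝ), (∀ i l, 0 ≤ U i l) ∧ (∀ l j, 0 ≤ V l j) ∧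
      ∀ i j, M i j = ∑ l, U i l * V l j := by
  classical
  -- row sums `ℓ_i = α_i L0 + β_i L1`
  have hℓ : ∀ i, ∑ j, M i j = a0 i * ∑ j, b0 j + a1 i * ∑ j, b1 j := fun i => by
    simp only [hfac, Finset.sum_add_distrib, Finset.mul_sum]
  have hℓnn : ∀ i, 0 ≤ ∑ j, M i j := fun i => Finset.sum_nonneg fun j _ => hM i j
  have hℓ0 : ∀ i, ∑ j, M i j = 0 → ∀ j, M i j = 0 := fun i hi j =>
    (Finset.sum_eq_zero_iff_of_nonneg fun j _ => hM i j).mp hi j (Finset.mem_univ j)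
  -- the normalised nonzero rows lie on the affine line `base + t • dir`
  have hrow : ∀ i, ∑ j, M i j ≠ 0 → ∀ j, M i j = (∑ j, M i j) *
      (b1 j / ∑ j, b1 j + (a0 i / ∑ j, M i j) * (b0 j - (∑ j, b0 j) / (∑ j, b1 j) * b1 j)) := by
    intro i hi j
    have hℓi := hℓ i
    rw [hfac i j]
    field_simp
    rw [hℓi]
    ring
  -- the nonzero rows and their extreme parameters
  set I : Finset ι := univ.filter fun i => ∑ j, M i j ≠ 0 with hI
  by_cases hIne : I.Nonempty
  · obtain ⟨i₁, hi₁, hmin⟩ := Finset.exists_min_image I (fun i => a0 i / ∑ j, M i j) hIne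
    obtain ⟨i₂, hi₂, hmax⟩ := Finset.exists_max_image I (fun i => a0 i / ∑ j, M i j) hIne
    have hi₁' : ∑ j, M i₁ j ≠ 0 := (Finset.mem_filter.mp hi₁).2
    have hi₂' : ∑ j, M i₂ j ≠ 0 := (Finset.mem_filter.mp hi₂).2
    -- the two nonnegative generators `y1 = row i₁ / ℓ_{i₁}`, `y2 = row i₂ / ℓ_{i₂}`
    set base : κ → ℝ := fun j => b1 j / ∑ j, b1 j with hbase
    set dir : κ → ℝ := fun j => b0 j - (∑ j, b0 j) / (∑ j, b1 j) * b1 j with hdir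
    set t : ι → ℝ := fun i => a0 i / ∑ j, M i j with ht
    have hrow' : ∀ i, ∑ j, M i j ≠ 0 → ∀ j, M i j = (∑ j, M i j) * (base j + t i * dir j) :=
      fun i hi j => hrow i hi j
    have hgen : ∀ i₀, ∑ j, M i₀ j ≠ 0 → ∀ j, 0 ≤ base j + t i₀ * dir j := by
      intro i₀ hi₀ j
      have hpos : 0 < ∑ j, M i₀ j := lt_of_le_of_ne (hℓnn i₀) (Ne.symm hi₀)
      have h := hM i₀ j
      rw [hrow' i₀ hi₀ j] at h
      exact (mul_nonneg_iff_of_pos_left hpos).mp h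
    -- barycentric coordinate of `t_i` in `[t_min, t_max]`
    set lam : ι → ℝ := fun i => (t i₂ - t i) / (t i₂ - t i₁) with hlam
    have hkey : ∀ i ∈ I, lam i * t i₁ + (1 - lam i) * t i₂ = t i := by
      intro i hi
      have h1 : t i₁ ≤ t i := hmin i hi
      have h2 : t i ≤ t i₂ := hmax i hi
      simp only [hlam]
      by_cases hd : t i₂ - t i₁ = 0
      · have : t i = t i₂ := by linarith [sub_eq_zero.mp hd]
        rw [hd, div_zero, this]
        ring
      · field_simp
        ring
    have hlam0 : ∀ i ∈ I, 0 ≤ lam i := fun i hi =>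
      div_nonneg (sub_nonneg.mpr (hmax i hi)) (sub_nonneg.mpr ((hmin i hi).trans (hmax i hi)))
    have hlam1 : ∀ i ∈ I, lam i ≤ 1 := by
      intro i hi
      have h1 : t i₁ ≤ t i := hmin i hi
      have h2 : t i ≤ t i₂ := hmax i hi
      simp only [hlam]
      rcases eq_or_lt_of_le (h1.trans h2) with h | h
      · rw [h, sub_self, div_zero]
        exact zero_le_one
      · rw [div_le_one (by linarith)]
        linarith
    refine ⟨fun i l => if l = 0 then (∑ j, M i j) * lam i else (∑ j, M i j) * (1 - lam i),
      fun l j => if l = 0 then base j + t i₁ * dir j else base j + t i₂ * dir j,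
      fun i l => ?_, fun l j => ?_, fun i j => ?_⟩
    · dsimp only
      by_cases hi : ∑ j, M i j = 0
      · simp [hi]
      · have hiI : i ∈ I := Finset.mem_filter.mpr ⟨Finset.mem_univ _, hi⟩
        split_ifs
        · exact mul_nonneg (hℓnn i) (hlam0 i hiI)
        · exact mul_nonneg (hℓnn i) (sub_nonneg.mpr (hlam1 i hiI))
    · dsimp only
      split_ifs
      · exact hgen i₁ hi₁' j
      · exact hgen i₂ hi₂' j
    · rw [Fin.sum_univ_two]
      simp only [if_true, show (1 : Fin 2) ≠ 0 from by decide, if_false]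
      by_cases hi : ∑ j, M i j = 0
      · rw [hi, hℓ0 i hi j]
        ring
      · have hiI : i ∈ I := Finset.mem_filter.mpr ⟨Finset.mem_univ _, hi⟩
        rw [hrow' i hi j, ← hkey i hiI]
        ring
  · -- all rows are zero
    have h0 : ∀ i j, M i j = 0 := fun i j => by
      have : ∑ j, M i j = 0 := by
        by_contra h
        exact hIne ⟨i, Finset.mem_filter.mpr ⟨Finset.mem_univ _, h⟩⟩
      exact hℓ0 i this j
    exact ⟨fun _ _ => 0, fun _ _ => 0, fun _ _ => le_rfl, fun _ _ => le_rfl, fun i j => by simp [h0 i j]⟩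

/-- **Cohen–Rothblum** (the input of Proposition 2.8: "if `rank(M) = 2` then `rank_+(M) = 2`"): an
entrywise nonnegative real matrix of rank `≤ 2` has a nonnegative factorization of size `2`.
[cite: FawziEtAl2015, Prop. 2.8 (p06)] -/
theorem exists_nonnegFactorization_two_of_rank_le_two [Fintype ι] [Fintype κ] {M : Matrix ι κ ℝ}
    (hM : ∀ i j, 0 ≤ M i j) (hr : M.rank ≤ 2) :
    ∃ (U : ι → Fin 2 → ℝ) (V : Fin 2 → κ → ℝ), (∀ i l, 0 ≤ U i l) ∧ (∀ l j, 0 ≤ V l j) ∧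
      ∀ i j, M i j = ∑ l, U i l * V l j := by
  obtain ⟨a, b, hab⟩ := exists_biFactorization_of_rank_le M hr
  have hfac : ∀ i j, M i j = a i 0 * b j 0 + a i 1 * b j 1 := fun i j => by
    rw [hab i j, Fin.sum_univ_two]
  by_cases hL1 : ∑ j, b j 1 ≠ 0
  · exact exists_nonnegFactorization_two_aux hM (fun i => a i 0) (fun i => a i 1) (fun j => b j 0)
      (fun j => b j 1) hfac hL1
  by_cases hL0 : ∑ j, b j 0 ≠ 0
  · exact exists_nonnegFactorization_two_aux hM (fun i => a i 1) (fun i => a i 0) (fun j => b j 1)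
      (fun j => b j 0) (fun i j => by rw [hfac]; ring) hL0
  · push Not at hL0 hL1
    have h0 : ∀ i j, M i j = 0 := by
      intro i
      have hs : ∑ j, M i j = 0 := by
        simp only [hfac, Finset.sum_add_distrib, ← Finset.mul_sum, hL0, hL1, mul_zero, add_zero]
      exact fun j => (Finset.sum_eq_zero_iff_of_nonneg fun j _ => hM i j).mp hs j (Finset.mem_univ j)
    exact ⟨fun _ _ => 0, fun _ _ => 0, fun _ _ => le_rfl, fun _ _ => le_rfl, fun i j => by simp [h0 i j]⟩

/-- **Rank one** (Proposition 2.8, first display): a nonzero nonnegative matrix of rank `≤ 1` is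
`a bᵀ` with `a, b ≥ 0` (take absolute values in a real rank-one factorization).
[cite: FawziEtAl2015, Prop. 2.8 (p06)] -/
theorem exists_nonnegFactorization_one_of_rank_le_one [Fintype ι] [Fintype κ] {M : Matrix ι κ ℝ}
    (hM : ∀ i j, 0 ≤ M i j) (hr : M.rank ≤ 1) :
    ∃ (a : ι → ℝ) (b : κ → ℝ), (∀ i, 0 ≤ a i) ∧ (∀ j, 0 ≤ b j) ∧ ∀ i j, M i j = a i * b j := by
  obtain ⟨a, b, hab⟩ := exists_biFactorization_of_rank_le M hr
  refine ⟨fun i => |a i 0|, fun j => |b j 0|, fun i => abs_nonneg _, fun j => abs_nonneg _,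
    fun i j => ?_⟩
  rw [← abs_mul, ← abs_of_nonneg (hM i j), hab i j, Fin.sum_univ_one]

/-- **Discharge of `FawziEtAl2015_prop28`** (Proposition 2.8: `rank = 1 ⇔ rank_+ = 1 ⇔ rank_psd = 1`;
`rank = 2 ⇒ rank_+ = rank_psd = 2`), from the rank-one and Cohen–Rothblum factorizations above,
`rank_psd ≤ rank_+` (`HasPsdFactorization.of_nonnegFactorization`) and Proposition 2.5
(`HasPsdFactorization.rank_le_choose`: a psd factorization of size `1` forces `rank ≤ 1`).
[cite: FawziEtAl2015, Prop. 2.8 (p06)] -/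
theorem FawziEtAl2015_prop28_holds : FawziEtAl2015_prop28 := by
  intro ι κ _ _ M hM
  classical
  -- `a bᵀ` with `M ≠ 0` has rank one
  have hrank1 : ∀ (a : ι → ℝ) (b : κ → ℝ), (∀ i j, M i j = a i * b j) → M ≠ 0 → M.rank = 1 := by
    intro a b hab hne
    have hle : M.rank ≤ 1 := by
      have : M = vecMulVec a b := by
        ext i j
        rw [hab, vecMulVec_apply]
      rw [this]
      exact rank_vecMulVec_le a b
    have hpos := rank_pos_of_ne_zero hne
    omega
  have hne_of_rank : M.rank = 1 → M ≠ 0 := by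
    intro h hM0
    rw [hM0, Matrix.rank_zero] at h
    exact zero_ne_one h
  refine ⟨⟨⟨fun h => ⟨hne_of_rank h, exists_nonnegFactorization_one_of_rank_le_one hM h.le⟩,
    fun ⟨hne, a, b, _, _, hab⟩ => hrank1 a b hab hne⟩, ⟨fun h => ⟨hne_of_rank h, ?_⟩,
    fun ⟨hne, hpsd⟩ => ?_⟩⟩, fun h2 => ⟨exists_nonnegFactorization_two_of_rank_le_two hM h2.le, ?_, ?_⟩⟩
  · -- `rank = 1 ⇒ rank_psd ≤ 1`
    obtain ⟨a, b, ha, hb, hab⟩ := exists_nonnegFactorization_one_of_rank_le_one hM h.le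
    exact HasPsdFactorization.of_nonnegFactorization (fun i _ => a i) (fun _ j => b j)
      (fun i _ => ha i) (fun _ j => hb j) (fun i j => by rw [Fin.sum_univ_one, hab])
  · -- `rank_psd ≤ 1`, `M ≠ 0 ⇒ rank = 1`
    have hle : M.rank ≤ (1 + 1).choose 2 := hpsd.rank_le_choose
    have hpos := rank_pos_of_ne_zero hne
    simp only [Nat.reduceAdd, Nat.choose_self] at hle
    omega
  · -- `rank = 2 ⇒ rank_psd ≤ 2`
    obtain ⟨U, V, hU, hV, hUV⟩ := exists_nonnegFactorization_two_of_rank_le_two hM h2.le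
    exact HasPsdFactorization.of_nonnegFactorization U V hU hV hUV
  · -- `rank = 2 ⇒ ¬ rank_psd ≤ 1`
    intro h1
    have hle : M.rank ≤ (1 + 1).choose 2 := h1.rank_le_choose
    simp only [Nat.reduceAdd, Nat.choose_self] at hle
    omega

end Prop28

/-! ### Normalising a psd family to a POVM by a congruence (the `Σ_A^{-1/2} A_i Σ_A^{-1/2}` step) -/

section CongrNormalisation

variable {k m : ℕ}

/-- `I − P Pᵀ` for the selection matrix `P` of the first `m` coordinates is the diagonal `0/1`
projector onto the last `k − m` coordinates. [folklore] -/
private theorem one_sub_padMatrix_one_castLE (hmk : m ≤ k) :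
    (1 : Matrix (Fin k) (Fin k) ℝ) - padMatrix (Fin.castLE hmk) 1 =
      diagonal fun s : Fin k => if (s : ℕ) < m then (0 : ℝ) else 1 := by
  classical
  have hP : ∀ (s : Fin k) (a : Fin m), selMatrix (Fin.castLE hmk) s a = if (s : ℕ) = a then 1 else 0 :=
    fun s a => by simp only [selMatrix, of_apply, Fin.ext_iff, Fin.val_castLE]
  ext s s'
  rw [Matrix.sub_apply, padMatrix_apply, Matrix.mul_one, Matrix.mul_apply, Matrix.one_apply,
    diagonal_apply]
  simp only [transpose_apply, hP]
  by_cases hs : (s : ℕ) < m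
  · rw [Finset.sum_eq_single (⟨s, hs⟩ : Fin m)]
    · by_cases hss : s = s'
      · subst hss
        simp [hs]
      · have h' : (s' : ℕ) ≠ s := fun h => hss (Fin.ext h.symm)
        simp [hss, h']
    · intro a _ ha
      have h' : (s : ℕ) ≠ a := fun h => ha (Fin.ext h.symm)
      simp [h']
    · simp
  · have h0 : ∀ a : Fin m, (s : ℕ) ≠ a := fun a h => hs (h ▸ a.2)
    simp [h0, hs]

/-- **Congruence normalisation of a psd family** (the step "`Σ_A = Σ_i A_i` can be assumed invertible
… `F_i = Σ_A^{-1/2} A_i Σ_A^{-1/2}`, so that `F_i ⪰ 0` and `Σ_i F_i = I_k`" of the printed proofs of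
Lemma 6.4 and Proposition 3.8, made exact at fixed size `k`): for a nonempty finite family of real psd
`k × k` matrices `A_i` there are psd `F_i` with `Σ_i F_i = I_k` and one matrix `R` with `A_i = Rᵀ F_i R`
for all `i` (compress to `(ker Σ_A)ᗮ`, write the compression of `Σ_A` as `RᵀR` with `R` invertible,
conjugate, pad back, and spread the complementary projector `I − PPᵀ` evenly over the `F_i`).
[cite: FawziEtAl2015, Lemma 6.4 proof (p18) and Prop. 3.8 proof (p12)] -/
theorem exists_posSemidef_sum_eq_one_congr {ι : Type*} [Fintype ι] [Nonempty ι]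
    (A : ι → Matrix (Fin k) (Fin k) ℝ) (hA : ∀ i, (A i).PosSemidef) :
    ∃ (R : Matrix (Fin k) (Fin k) ℝ) (F : ι → Matrix (Fin k) (Fin k) ℝ),
      (∀ i, (F i).PosSemidef) ∧ ∑ i, F i = 1 ∧ ∀ i, A i = Rᵀ * F i * R := by
  classical
  have hAt : ∀ i, (A i)ᵀ = A i := fun i => by
    simpa [conjTranspose_eq_transpose_of_trivial] using (hA i).1.eq
  -- `S = Σ_i A_i` and its kernel
  set S : Matrix (Fin k) (Fin k) ℝ := ∑ i, A i with hSdef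
  have hSpsd : S.PosSemidef := posSemidef_sum _ fun i _ => hA i
  have hkerA : ∀ (u : Fin k → ℝ), S *ᵥ u = 0 → ∀ i, A i *ᵥ u = 0 := by
    intro u hu i
    have hsum : ∑ i', u ⬝ᵥ (A i' *ᵥ u) = 0 := by
      rw [← dotProduct_sum, ← Matrix.sum_mulVec, ← hSdef, hu, dotProduct_zero]
    have hnn : ∀ i', 0 ≤ u ⬝ᵥ (A i' *ᵥ u) := fun i' => by
      simpa using (posSemidef_iff_dotProduct_mulVec.mp (hA i')).2 u
    have h0 : u ⬝ᵥ (A i *ᵥ u) = 0 :=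
      le_antisymm (by rw [← hsum]; exact single_le_sum (fun i' _ => hnn i') (mem_univ i)) (hnn i)
    have h0' : star u ⬝ᵥ (A i *ᵥ u) = 0 := by simpa using h0
    exact (hA i).dotProduct_mulVec_zero_iff u |>.mp h0'
  let kerS : Submodule ℝ (EuclideanSpace ℝ (Fin k)) :=
    { carrier := {v | S *ᵥ v.ofLp = 0}
      add_mem' := fun {u v} hu hv => by
        simp only [Set.mem_setOf_eq] at hu hv ⊢
        rw [WithLp.ofLp_add, mulVec_add, hu, hv, add_zero]
      zero_mem' := by simp
      smul_mem' := fun c v hv => by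
        simp only [Set.mem_setOf_eq] at hv ⊢
        rw [WithLp.ofLp_smul, mulVec_smul, hv, smul_zero] }
  let G : Submodule ℝ (EuclideanSpace ℝ (Fin k)) := kerSᗮ
  -- the `A_i` have range in `G`
  have hAG : ∀ i (w : Fin k → ℝ), WithLp.toLp 2 (A i *ᵥ w) ∈ G := fun i w => by
    rw [Submodule.mem_orthogonal]
    intro u hu
    have hu' : A i *ᵥ u.ofLp = 0 := hkerA _ hu i
    have hinner : inner ℝ u (WithLp.toLp 2 (A i *ᵥ w)) = u.ofLp ⬝ᵥ (A i *ᵥ w) := by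
      simp [PiLp.inner_apply, dotProduct, mul_comm]
    rw [hinner, dotProduct_mulVec, ← mulVec_transpose, hAt, hu', zero_dotProduct]
  -- compression to `G`
  let bG := stdOrthonormalBasis ℝ G
  set m := Module.finrank ℝ G with hmdef
  have hmk : m ≤ k := by
    have h := Submodule.finrank_le G
    rwa [finrank_euclideanSpace, Fintype.card_fin] at h
  set Qm : Matrix (Fin k) (Fin m) ℝ := onbMatrix bG with hQm
  have hQtQ : Qmᵀ * Qm = 1 := onbMatrix_transpose_mul_self bG
  have hQmem : ∀ v : Fin m → ℝ, WithLp.toLp 2 (Qm *ᵥ v) ∈ G := fun v => by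
    have hrepr : WithLp.toLp 2 (Qm *ᵥ v) = ∑ a, v a • (bG a : EuclideanSpace ℝ (Fin k)) := by
      ext s
      simp [hQm, onbMatrix, mulVec, dotProduct, WithLp.ofLp_sum, Finset.sum_apply, mul_comm]
    rw [hrepr]
    exact Submodule.sum_mem _ fun a _ => Submodule.smul_mem _ _ (bG a).2
  have hQQA : ∀ i, Qm * Qmᵀ * A i = A i := fun i => onbMatrix_proj_mul bG (hAG i)
  have hAQQ : ∀ i, A i * (Qm * Qmᵀ) = A i := fun i => by
    have h := congrArg transpose (hQQA i)
    rw [transpose_mul, transpose_mul, transpose_transpose, hAt] at h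
    exact h
  let A' : ι → Matrix (Fin m) (Fin m) ℝ := fun i => Qmᵀ * A i * Qm
  have hA' : ∀ i, (A' i).PosSemidef := fun i => by
    simpa [A', conjTranspose_eq_transpose_of_trivial] using (hA i).conjTranspose_mul_mul_same Qm
  have hAA' : ∀ i, A i = Qm * A' i * Qmᵀ := fun i => by
    calc A i = Qm * Qmᵀ * A i * (Qm * Qmᵀ) := by rw [hQQA, hAQQ]
      _ = Qm * (Qmᵀ * A i * Qm) * Qmᵀ := by simp only [Matrix.mul_assoc]
  -- `S' = Qᵀ S Q = Σ_i A'_i` is positive definite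
  set S' : Matrix (Fin m) (Fin m) ℝ := ∑ i, A' i with hS'def
  have hS'eq : S' = Qmᵀ * S * Qm := by
    rw [hS'def, hSdef, Matrix.mul_sum, Matrix.sum_mul]
  have hS'psd : S'.PosSemidef := posSemidef_sum _ fun i _ => hA' i
  have hS'pd : S'.PosDef := by
    refine posDef_iff_dotProduct_mulVec.mpr ⟨hS'psd.1, fun x hx => lt_of_le_of_ne ?_ ?_⟩
    · exact (posSemidef_iff_dotProduct_mulVec.mp hS'psd).2 x
    · intro h0
      have h1 : star (Qm *ᵥ x) ⬝ᵥ (S *ᵥ (Qm *ᵥ x)) = 0 := by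
        have hq : (Qm *ᵥ x) ⬝ᵥ (S *ᵥ (Qm *ᵥ x)) = x ⬝ᵥ ((Qmᵀ * S * Qm) *ᵥ x) := by
          rw [← mulVec_mulVec, ← mulVec_mulVec, dotProduct_mulVec x Qmᵀ, vecMul_transpose]
        have h0' : x ⬝ᵥ (S' *ᵥ x) = 0 := by simpa using h0.symm
        rw [star_trivial, hq, ← hS'eq, h0']
      have h2 : S *ᵥ (Qm *ᵥ x) = 0 := (hSpsd.dotProduct_mulVec_zero_iff _).mp h1
      have hmemK : WithLp.toLp 2 (Qm *ᵥ x) ∈ kerS := by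
        change S *ᵥ (WithLp.toLp 2 (Qm *ᵥ x)).ofLp = 0
        simpa using h2
      have hmemG : WithLp.toLp 2 (Qm *ᵥ x) ∈ G := hQmem x
      have hzero : WithLp.toLp 2 (Qm *ᵥ x) = 0 := by
        have h := (Submodule.mem_orthogonal kerS _).mp hmemG _ hmemK
        exact inner_self_eq_zero.mp h
      have hQx : Qm *ᵥ x = 0 := by
        have h := congrArg WithLp.ofLp hzero
        simpa using h
      apply hx
      calc x = (Qmᵀ * Qm) *ᵥ x := by rw [hQtQ, one_mulVec]
        _ = 0 := by rw [← mulVec_mulVec, hQx, mulVec_zero]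
  -- `S' = Rᵀ R` with `R` invertible; conjugate by `R⁻¹`
  obtain ⟨Rm, hRm⟩ := CStarAlgebra.nonneg_iff_eq_star_mul_self.mp hS'psd.nonneg
  have hRt : star Rm = Rmᵀ := by rw [star_eq_conjTranspose, conjTranspose_eq_transpose_of_trivial]
  rw [hRt] at hRm
  have hRdet : IsUnit Rm.det := by
    have hd : S'.det ≠ 0 := ne_of_gt hS'pd.det_pos
    rw [hRm, det_mul, det_transpose] at hd
    exact isUnit_iff_ne_zero.mpr (fun h => hd (by rw [h, mul_zero]))
  have hRRinv : Rm * Rm⁻¹ = 1 := Matrix.mul_nonsing_inv Rm hRdet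
  have hRinvR : Rm⁻¹ * Rm = 1 := Matrix.nonsing_inv_mul Rm hRdet
  let A'' : ι → Matrix (Fin m) (Fin m) ℝ := fun i => (Rm⁻¹)ᵀ * A' i * Rm⁻¹
  have hA'' : ∀ i, (A'' i).PosSemidef := fun i => by
    simpa [A'', conjTranspose_eq_transpose_of_trivial] using (hA' i).conjTranspose_mul_mul_same Rm⁻¹
  have hsumA'' : ∑ i, A'' i = 1 := by
    have h : ∑ i, A'' i = (Rm⁻¹)ᵀ * S' * Rm⁻¹ := by
      rw [hS'def, Matrix.mul_sum, Matrix.sum_mul]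
    rw [h, hRm]
    calc (Rm⁻¹)ᵀ * (Rmᵀ * Rm) * Rm⁻¹ = (Rm * Rm⁻¹)ᵀ * (Rm * Rm⁻¹) := by
          rw [transpose_mul]; simp only [Matrix.mul_assoc]
      _ = 1 := by rw [hRRinv, transpose_one, Matrix.one_mul]
  have hA'A'' : ∀ i, A' i = Rmᵀ * A'' i * Rm := fun i => by
    calc A' i = (Rm⁻¹ * Rm)ᵀ * A' i * (Rm⁻¹ * Rm) := by rw [hRinvR, transpose_one, Matrix.one_mul,
          Matrix.mul_one]
      _ = Rmᵀ * ((Rm⁻¹)ᵀ * A' i * Rm⁻¹) * Rm := by rw [transpose_mul]; simp only [Matrix.mul_assoc]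
  -- pad back to size `k`, spreading the complementary projector over the family
  set e : Fin m → Fin k := Fin.castLE hmk with he
  have hinj : Function.Injective e := Fin.castLE_injective hmk
  have hPtP : (selMatrix e)ᵀ * selMatrix e = 1 := selMatrix_transpose_mul_self hinj
  set D : Matrix (Fin k) (Fin k) ℝ := 1 - padMatrix e 1 with hD
  have hDpsd : D.PosSemidef := by
    rw [hD, he, one_sub_padMatrix_one_castLE hmk]
    exact posSemidef_diagonal_iff.mpr fun s => by split_ifs <;> norm_num
  have hPtDP : (selMatrix e)ᵀ * D * selMatrix e = 0 := by
    rw [hD, padMatrix_apply, Matrix.mul_one, Matrix.mul_sub, Matrix.sub_mul, Matrix.mul_one, hPtP]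
    calc (1 : Matrix (Fin m) (Fin m) ℝ) - (selMatrix e)ᵀ * (selMatrix e * (selMatrix e)ᵀ) * selMatrix e
        = 1 - ((selMatrix e)ᵀ * selMatrix e) * ((selMatrix e)ᵀ * selMatrix e) := by
          simp only [Matrix.mul_assoc]
      _ = 0 := by rw [hPtP, Matrix.one_mul, sub_self]
  set c : ℝ := (Fintype.card ι : ℝ)⁻¹ with hc
  have hcnn : 0 ≤ c := by rw [hc]; positivity
  refine ⟨selMatrix e * Rm * Qmᵀ, fun i => padMatrix e (A'' i) + c • D, fun i => ?_, ?_, fun i => ?_⟩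
  · exact (posSemidef_padMatrix (hA'' i)).add (hDpsd.smul hcnn)
  · rw [Finset.sum_add_distrib, ← map_sum, hsumA'', Finset.sum_const, Finset.card_univ, ← Nat.cast_smul_eq_nsmul ℝ,
      smul_smul, hc, mul_inv_cancel₀ (by exact_mod_cast Fintype.card_ne_zero), one_smul, hD,
      add_sub_cancel]
  · rw [hAA' i, hA'A'' i, transpose_mul, transpose_mul, transpose_transpose, Matrix.mul_add,
      Matrix.add_mul, Matrix.mul_smul, Matrix.smul_mul, padMatrix_apply]
    have h1 : Qm * (Rmᵀ * (selMatrix e)ᵀ) * (selMatrix e * A'' i * (selMatrix e)ᵀ) *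
        (selMatrix e * Rm * Qmᵀ) = Qm * (Rmᵀ * A'' i * Rm) * Qmᵀ := by
      calc Qm * (Rmᵀ * (selMatrix e)ᵀ) * (selMatrix e * A'' i * (selMatrix e)ᵀ) * (selMatrix e * Rm * Qmᵀ)
          = Qm * Rmᵀ * ((selMatrix e)ᵀ * selMatrix e) * A'' i * ((selMatrix e)ᵀ * selMatrix e) *
              Rm * Qmᵀ := by simp only [Matrix.mul_assoc]
        _ = Qm * (Rmᵀ * A'' i * Rm) * Qmᵀ := by
            rw [hPtP, Matrix.mul_one, Matrix.mul_one]
            simp only [Matrix.mul_assoc]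
    have h2 : Qm * (Rmᵀ * (selMatrix e)ᵀ) * D * (selMatrix e * Rm * Qmᵀ) = 0 := by
      calc Qm * (Rmᵀ * (selMatrix e)ᵀ) * D * (selMatrix e * Rm * Qmᵀ)
          = Qm * Rmᵀ * ((selMatrix e)ᵀ * D * selMatrix e) * Rm * Qmᵀ := by simp only [Matrix.mul_assoc]
        _ = 0 := by rw [hPtDP]; simp
    rw [h1, h2, smul_zero, add_zero]

end CongrNormalisation

end Literature.Combinatorics.Optimization
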